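import Literature.NumberTheory.LFunctions.PagePNTExceptionalData
import Mathlib.Analysis.ODE.Gronwall
import HarnessLib

/-!
# `1/L(s, χ)` and `L'/L(s, χ)` near `σ = 1`, sharp in `log qτ`
# (Montgomery–Vaughan Theorem 11.4: (11.5), (11.7), (11.8), (11.10))

Topic `Literature/NumberTheory/LFunctions`. Everything in this file is PROVED (theorems only).

The tree's `DirichletLFunctionLogDerivBound.lean` proves a CRUDE form of MV Theorem 11.4,
`‖L'/L(s, χ)‖ ≤ C ℒ₀³ d⁻¹ log(|t|+4)` (`d` = distance to the exceptional zeros), which suffices for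
the prime number theorem in progressions but not for bounds on `1/L(s, χ)` (these come from
integrating `L'/L` over a segment of length `≍ 1/ℒ`, so `L'/L` must be `O(ℒ)` up to the polar
term). Here we prove the sharp statements, uniformly in `q` with absolute constants
(`ℒ = log q + log(|t| + 4)`, `ℒ₀ = log q + log 4`):

* `exists_norm_logDeriv_sub_polar_le` — **MV (11.5)/(11.8)**: for `χ ≠ χ₀` mod `q` and
  `σ ≥ 1 − c/ℒ`: `‖L'/L(s, χ)‖ ≤ C ℒ` if `L(s, χ)` has no real zero `β > 1 − 2c/ℒ₀`, and
  `‖L'/L(s, χ) − 1/(s − β)‖ ≤ C ℒ` (`s ≠ β`) if `β` is such a zero (there is at most one, and it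
  is simple — MV Theorem 11.3, Case 4, from `LandauPageRealZeros.lean` and
  `ExceptionalZeroSimple.lean`);
* `exists_inv_LFunction_bounds` — **MV (11.7)/(11.10)**: under the same alternatives,
  `‖1/L(s, χ)‖ ≤ C ℒ`, respectively `‖1/L(s, χ)‖ ≤ C ℒ (1 + 1/|s − β|)` and `‖1/L'(β, χ)‖ ≤ C ℒ₀`.

Proofs as in MV pp. 277–278: the Lemma-α package `L'/L(z) = ψ(z) + ∑_{a ∈ S} m(a)/(z − a)`
(`DirichletLFunctionBounds.lean`, here re-exported with the holomorphy of `ψ`,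
`exists_logDeriv_package'`), the comparison `1/(s−ρ) − 1/(s₁−ρ) ≪ Re 1/(s₁−ρ)` for the zeros at
distance `≥ c/ℒ` from `s` ((11.12)–(11.13)) against `∑ m(a) Re 1/(s₁ − a) ≤ |L'/L(s₁)| + |ψ(s₁)| ≪ ℒ`
((11.11)), and the observation that a zero closer than `c/ℒ` to `s` is the exceptional `β`, with
weight `m(β) = 1` (`mult_eq_one`), whose term is the subtracted `1/(s − β)`. The bounds for `1/L`
follow by Grönwall's inequality along `[σ, 1 + 1/(8ℒ)] + it` applied to `L` or to
`g(s) = L(s, χ)/(s − β)` (Mathlib's `dslope`; the tree's `PagePNTExceptionalData.lean`), starting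
from `‖L(s₁, χ)‖ ≥ (σ₁ − 1)/σ₁` (`norm_LFunction_ge`).

These are the inputs for the Möbius analogues of the Siegel–Walfisz theorem (MV §11.3,
Exercises 7–8 and 13), where `1/L(s, χ)` replaces `L'/L(s, χ)`.

## References

* H. L. Montgomery, R. C. Vaughan, *Multiplicative Number Theory I. Classical Theory*, Cambridge
  Stud. Adv. Math. 97 (2007), §11.1, Theorem 11.4 and its proof, (11.5)–(11.13), pp. 360–361
  (`MontgomeryVaughan2007`).
* E. C. Titchmarsh, *The Theory of the Riemann Zeta-Function*, 2nd ed. (1986), §3.9 Lemma α and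
  Theorem 3.11, (3.11.6)–(3.11.8) (`Titchmarsh1986`).
-/

noncomputable section

open Complex Filter Topology Metric Set Finset


namespace Literature.NumberTheory.LFunctions.DirichletZFR

/-! ## MV Lemma 11.1 with the holomorphy of the remainder kept -/

/-- **Montgomery–Vaughan Lemma 11.1** (non-principal case) exactly as
`exists_logDeriv_package`, but keeping from Titchmarsh's Lemma α the holomorphy of the remainder
`ψ(z) = L'/L(z, χ) − ∑_{a ∈ S} m(a)/(z − a)` on the open disc `|z − c| < 13/32`,
`c = 17/16 + it` (needed to identify the weights `m(a)` with multiplicities at zeros that are not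
close to the centre). [cite: MontgomeryVaughan2007, Lemma 11.1] -/
theorem exists_logDeriv_package' :
    ∃ E : ℝ, 0 ≤ E ∧ ∀ (q : ℕ) [NeZero q] (χ : DirichletCharacter ℂ q), χ ≠ 1 → ∀ t : ℝ,
      ∃ (S : Finset ℂ) (m : ℂ → ℕ) (ψ : ℂ → ℂ),
        (∀ a ∈ S, χ.LFunction a = 0 ∧ 0 < m a ∧ ‖a - (17 / 16 + t * I)‖ ≤ 13 / 32) ∧
        (∀ a, χ.LFunction a = 0 → ‖a - (17 / 16 + t * I)‖ ≤ 13 / 32 → a ∈ S) ∧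
        DifferentiableOn ℂ ψ (ball (17 / 16 + t * I) (13 / 32)) ∧
        (∀ z ∈ ball (17 / 16 + t * I) (13 / 32), χ.LFunction z ≠ 0 →
          ψ z = deriv χ.LFunction z / χ.LFunction z - ∑ a ∈ S, (m a : ℂ) / (z - a)) ∧
        (∀ z ∈ closedBall (17 / 16 + t * I) (13 / 128),
          ‖ψ z‖ ≤ E * (Real.log q + Real.log (|t| + 4))) := by
  set Z : ℝ := ∑' n : ℕ, ((n + 1 : ℕ) : ℝ) ^ (-(5 / 4 : ℝ)) with hZ
  have hZ1 : 1 ≤ Z := one_le_tsum_rpow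
  have hE₀ : 0 ≤ Real.log (17 * Z) := Real.log_nonneg (by linarith)
  set R : ℝ := 13 / 32 with hR
  have hRpos : 0 < R := by norm_num
  refine ⟨8 * (Real.log (17 * Z) + 2) / R, by positivity, fun q _ χ hχ t ↦ ?_⟩
  set c : ℂ := 17 / 16 + t * I with hcdef
  have hcre : c.re = 17 / 16 := by simp [hcdef]
  have hcim : c.im = t := by simp [hcdef]
  have hq : (1 : ℝ) ≤ q := by exact_mod_cast NeZero.one_le
  set M : ℝ := q * (|t| + 4) * Z with hMdef
  have hM : ∀ z ∈ closedBall c (2 * R), ‖χ.LFunction z‖ ≤ M := by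
    intro z hz
    rw [mem_closedBall, dist_eq_norm] at hz
    have hre : |(z - c).re| ≤ ‖z - c‖ := Complex.abs_re_le_norm _
    have him : |(z - c).im| ≤ ‖z - c‖ := Complex.abs_im_le_norm _
    simp only [Complex.sub_re, hcre, Complex.sub_im, hcim] at hre him
    have hzre : 1 / 4 ≤ z.re := by
      have := neg_abs_le (z.re - 17 / 16)
      rw [hR] at hz; linarith
    have hzn : ‖z‖ ≤ |t| + 4 := by
      have h1 := Complex.norm_le_abs_re_add_abs_im z
      have h2 : |z.re| ≤ 17 / 16 + 13 / 16 := by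
        have h2a := le_abs_self (z.re - 17 / 16)
        have h2b := neg_abs_le (z.re - 17 / 16)
        rw [hR] at hz
        rw [abs_le]; constructor <;> linarith
      have h3 : |z.im| ≤ |t| + 13 / 16 := by
        have := abs_sub_abs_le_abs_sub z.im t
        rw [hR] at hz; linarith
      linarith
    calc ‖χ.LFunction z‖ ≤ q * ‖z‖ * Z := norm_LFunction_le_of_re_ge χ hχ hzre
      _ ≤ q * (|t| + 4) * Z := by gcongr
  have hc1 : 1 < c.re := by rw [hcre]; norm_num
  have hlow : 1 / 17 ≤ ‖χ.LFunction c‖ := by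
    have := norm_LFunction_ge χ hc1
    rw [hcre] at this
    norm_num at this
    exact this
  have hc0 : χ.LFunction c ≠ 0 := by
    intro h; rw [h, norm_zero] at hlow; norm_num at hlow
  obtain ⟨S, m, ψ, hS, hS', hψd, hψ, hψb, -⟩ :=
    Literature.Analysis.Complex.titchmarsh_logDeriv_sub_sum
      (DirichletCharacter.differentiable_LFunction hχ) hc0 hRpos hM
  refine ⟨S, m, ψ, hS, hS', hψd, hψ,
    fun z hz ↦ (hψb z (by rw [hR]; convert hz using 2; norm_num)).trans ?_⟩
  have hMpos : 0 < M := by positivity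
  have hℓ := one_le_ell q t
  have hlog : Real.log (M / ‖χ.LFunction c‖) ≤
      Real.log (17 * Z) + (Real.log q + Real.log (|t| + 4)) := by
    have hpos : 0 < ‖χ.LFunction c‖ := by linarith
    have h1 : M / ‖χ.LFunction c‖ ≤ 17 * M := by
      rw [div_le_iff₀ hpos]; nlinarith
    calc Real.log (M / ‖χ.LFunction c‖) ≤ Real.log (17 * M) :=
          Real.log_le_log (by positivity) h1
      _ = Real.log (17 * Z) + (Real.log q + Real.log (|t| + 4)) := by
          rw [hMdef, show (17 : ℝ) * (q * (|t| + 4) * Z) = (17 * Z) * q * (|t| + 4) by ring,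
            Real.log_mul (by positivity) (by positivity),
            Real.log_mul (by positivity) (by positivity)]
          ring
  rw [div_mul_eq_mul_div, hR]
  rw [div_le_div_iff_of_pos_right (by norm_num : (0:ℝ) < 13 / 32)]
  have : Real.log (17 * Z) ≤ Real.log (17 * Z) * (Real.log q + Real.log (|t| + 4)) := by
    nlinarith
  nlinarith

/-! ## Elementary lemmas -/

/-- The comparison inequality of Montgomery–Vaughan (6.11)/(11.12) with the separation of `s`
from the zero `a` measured by the distance `‖s − a‖ ≥ d` (rather than horizontally): if `s`, `s₁`
have the same ordinate, `Re s ≤ Re s₁ ≤ Re s + w`, `‖s − a‖ ≥ d > 0` and `Re s₁ − Re a ≥ κ > 0`,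
then `|1/(s−a) − 1/(s₁−a)| ≤ (w/κ)(w/d + 1) Re (1/(s₁ − a))`.
[cite: MontgomeryVaughan2007, Theorem 11.4 (proof, (11.12)-(11.13))] -/
theorem norm_inv_sub_inv_le_of_norm {s s₁ a : ℂ} {w d κ : ℝ} (hd : 0 < d) (hκ : 0 < κ)
    (him : s.im = s₁.im) (hσ : s.re ≤ s₁.re) (hws : s₁.re - s.re ≤ w)
    (hsa : d ≤ ‖s - a‖) (hκa : κ ≤ s₁.re - a.re) :
    ‖(s - a)⁻¹ - (s₁ - a)⁻¹‖ ≤ w / κ * (w / d + 1) * ((s₁ - a)⁻¹).re := by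
  have hw : 0 ≤ w := by linarith
  have hs₁a : κ ≤ ‖s₁ - a‖ :=
    hκa.trans ((Complex.abs_re_le_norm (s₁ - a)).trans' (by simp [le_abs_self]))
  have hsa0 : 0 < ‖s - a‖ := hd.trans_le hsa
  have hs₁a0 : 0 < ‖s₁ - a‖ := hκ.trans_le hs₁a
  have hsane : s - a ≠ 0 := norm_pos_iff.1 hsa0
  have hs₁ane : s₁ - a ≠ 0 := norm_pos_iff.1 hs₁a0
  have hs₁s : ‖s₁ - s‖ ≤ w := by
    have : s₁ - s = ((s₁.re - s.re : ℝ) : ℂ) := by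
      apply Complex.ext <;> simp [him]
    rw [this, Complex.norm_real, Real.norm_of_nonneg (by linarith)]
    exact hws
  have hid : (s - a)⁻¹ - (s₁ - a)⁻¹ = (s₁ - s) / ((s - a) * (s₁ - a)) := by
    field_simp; ring
  rw [hid, norm_div, norm_mul]
  have h1 : ‖s₁ - a‖ ≤ (w / d + 1) * ‖s - a‖ := by
    calc ‖s₁ - a‖ = ‖(s₁ - s) + (s - a)‖ := by ring_nf
      _ ≤ ‖s₁ - s‖ + ‖s - a‖ := norm_add_le _ _
      _ ≤ w + ‖s - a‖ := by gcongr
      _ ≤ w / d * ‖s - a‖ + ‖s - a‖ := by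
          gcongr
          calc w = w / d * d := by field_simp
            _ ≤ w / d * ‖s - a‖ := by gcongr
      _ = (w / d + 1) * ‖s - a‖ := by ring
  have h2 : κ / ‖s₁ - a‖ ^ 2 ≤ ((s₁ - a)⁻¹).re := by
    rw [Complex.inv_re, Complex.normSq_eq_norm_sq]
    gcongr
    simpa using hκa
  have h3 : ‖s₁ - s‖ / (‖s - a‖ * ‖s₁ - a‖) ≤ w * (w / d + 1) / ‖s₁ - a‖ ^ 2 := by
    rw [div_le_div_iff₀ (by positivity) (by positivity)]
    calc ‖s₁ - s‖ * ‖s₁ - a‖ ^ 2 = ‖s₁ - s‖ * ‖s₁ - a‖ * ‖s₁ - a‖ := by ring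
      _ ≤ w * ((w / d + 1) * ‖s - a‖) * ‖s₁ - a‖ := by gcongr
      _ = w * (w / d + 1) * (‖s - a‖ * ‖s₁ - a‖) := by ring
  calc ‖s₁ - s‖ / (‖s - a‖ * ‖s₁ - a‖) ≤ w * (w / d + 1) / ‖s₁ - a‖ ^ 2 := h3
    _ = w / κ * (w / d + 1) * (κ / ‖s₁ - a‖ ^ 2) := by field_simp
    _ ≤ w / κ * (w / d + 1) * ((s₁ - a)⁻¹).re := by gcongr

/-- **The weight of a simple zero is `1`.** In a Lemma-α package for `L(·, χ)` (`χ ≠ χ₀`) on the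
disc `|z − c| < R`, a zero `b ∈ S` lying in the open disc with `L'(b, χ) ≠ 0` has weight
`m(b) = 1` (the weights are the multiplicities, `mult_eq_analyticOrderAt`). [folklore] -/
theorem mult_eq_one {q : ℕ} [NeZero q] (χ : DirichletCharacter ℂ q) (hχ : χ ≠ 1)
    {S : Finset ℂ} {m : ℂ → ℕ} {ψ : ℂ → ℂ} {c b : ℂ} {R : ℝ}
    (hψd : DifferentiableOn ℂ ψ (ball c R))
    (hψ : ∀ z ∈ ball c R, χ.LFunction z ≠ 0 →
      ψ z = deriv χ.LFunction z / χ.LFunction z - ∑ a ∈ S, (m a : ℂ) / (z - a))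
    (hb : b ∈ S) (hbR : b ∈ ball c R) (hLb : χ.LFunction b = 0)
    (hderiv : deriv χ.LFunction b ≠ 0) : m b = 1 := by
  have hdiff := DirichletCharacter.differentiable_LFunction hχ
  have hfa : AnalyticAt ℂ χ.LFunction b := hdiff.analyticAt _
  -- a compact neighbourhood of `b` inside the disc, on which `ψ` is bounded
  obtain ⟨r, hr0, hrsub⟩ : ∃ r : ℝ, 0 < r ∧ closedBall b r ⊆ ball c R := by
    obtain ⟨ε, hε, hεsub⟩ := Metric.isOpen_iff.1 isOpen_ball b hbR
    exact ⟨ε / 2, by positivity, (closedBall_subset_ball (by linarith)).trans hεsub⟩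
  have hU : closedBall b r ∈ 𝓝 b := closedBall_mem_nhds b hr0
  have hcont : ContinuousOn ψ (closedBall b r) := hψd.continuousOn.mono hrsub
  obtain ⟨B, hB⟩ := (isCompact_closedBall b r).exists_bound_of_continuousOn hcont
  have hψU : ∀ z ∈ closedBall b r, χ.LFunction z ≠ 0 →
      ψ z = deriv χ.LFunction z / χ.LFunction z - ∑ a ∈ S, (m a : ℂ) / (z - a) :=
    fun z hz hz0 ↦ hψ z (hrsub hz) hz0
  -- finite order (identity theorem: `L(2, χ) ≠ 0`)
  have hfin : analyticOrderAt χ.LFunction b ≠ ⊤ := by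
    have h2 : analyticOrderAt χ.LFunction (2 : ℂ) ≠ ⊤ := by
      have hne : χ.LFunction 2 ≠ 0 :=
        DirichletCharacter.LFunction_ne_zero_of_one_le_re χ (Or.inl hχ) (by norm_num)
      rw [(hdiff.analyticAt 2).analyticOrderAt_eq_zero.2 hne]
      exact ENat.zero_ne_top
    exact AnalyticOnNhd.analyticOrderAt_ne_top_of_isPreconnected (U := Set.univ)
      (fun z _ ↦ hdiff.analyticAt z) isPreconnected_univ (Set.mem_univ _) (Set.mem_univ _) h2
  have hm : (m b : ℕ∞) = analyticOrderAt χ.LFunction b :=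
    mult_eq_analyticOrderAt hdiff hU hb hLb hψU hB hfin
  -- the order is exactly `1`
  have h1 : (1 : ℕ∞) ≤ analyticOrderAt χ.LFunction b := by
    rw [show (1 : ℕ∞) = ((1 : ℕ) : ℕ∞) from rfl,
      natCast_le_analyticOrderAt_iff_iteratedDeriv_eq_zero hfa]
    intro i hi
    interval_cases i
    simpa [iteratedDeriv_zero] using hLb
  have h2 : ¬ (2 : ℕ∞) ≤ analyticOrderAt χ.LFunction b := by
    rw [show (2 : ℕ∞) = ((2 : ℕ) : ℕ∞) from rfl,
      natCast_le_analyticOrderAt_iff_iteratedDeriv_eq_zero hfa]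
    intro h
    have := h 1 (by norm_num)
    rw [iteratedDeriv_one] at this
    exact hderiv this
  rw [← hm] at h1 h2
  have h1' : 1 ≤ m b := by exact_mod_cast h1
  have h2' : ¬ 2 ≤ m b := fun h ↦ h2 (by exact_mod_cast h)
  omega

/-- **Grönwall along a horizontal segment.** If `G` is entire and `‖G'(u + it)‖ ≤ K ‖G(u + it)‖`
for `σ ≤ u < σ₁`, then `‖G(σ₁ + it)‖ ≤ ‖G(σ + it)‖ e^{K(σ₁ − σ)}` (Titchmarsh's integration of the
logarithmic derivative, (3.11.6)–(3.11.8)). [cite: Titchmarsh1986, Theorem 3.11 eq. (3.11.6) to (3.11.8)] -/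
theorem norm_le_norm_mul_exp_of_deriv_le {G : ℂ → ℂ} (hG : Differentiable ℂ G) {σ σ₁ t K : ℝ}
    (hσ : σ ≤ σ₁)
    (hb : ∀ u ∈ Set.Ico σ σ₁, ‖deriv G (u + t * I)‖ ≤ K * ‖G (u + t * I)‖) :
    ‖G (σ₁ + t * I)‖ ≤ ‖G (σ + t * I)‖ * Real.exp (K * (σ₁ - σ)) := by
  set f : ℝ → ℂ := fun u ↦ G (u + t * I) with hfdef
  have hderiv : ∀ u : ℝ, HasDerivAt f (deriv G (u + t * I)) u := by
    intro u
    have h1 : HasDerivAt (fun z : ℂ ↦ z + t * I) 1 (u : ℂ) := (hasDerivAt_id (u : ℂ)).add_const _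
    have h2 : HasDerivAt G (deriv G (u + t * I)) ((u : ℂ) + t * I) := (hG _).hasDerivAt
    have h3 := h2.comp (u : ℂ) h1
    rw [mul_one] at h3
    exact h3.comp_ofReal
  have hcont : ContinuousOn f (Set.Icc σ σ₁) := fun u _ ↦
    (hderiv u).continuousAt.continuousWithinAt
  have hGr := norm_le_gronwallBound_of_norm_deriv_right_le (f := f)
    (f' := fun u ↦ deriv G (u + t * I)) (δ := ‖f σ‖) (K := K) (ε := 0) (a := σ) (b := σ₁)
    hcont (fun u _ ↦ (hderiv u).hasDerivWithinAt) le_rfl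
    (fun u hu ↦ by rw [add_zero]; exact hb u hu)
  have h := hGr σ₁ (Set.right_mem_Icc.2 hσ)
  rwa [gronwallBound_ε0] at h

/-- Passing to the limit in the Grönwall hypothesis at one exceptional abscissa: if `G` is entire
and `‖G'(u + it)‖ ≤ K ‖G(u + it)‖` for all `u ∈ (b, σ₁)`, then the same holds at `u = b`
(`b < σ₁`), by continuity of `G` and `G'`. [folklore] -/
theorem deriv_le_at_left_of_Ioo {G : ℂ → ℂ} (hG : Differentiable ℂ G) {b σ₁ t K : ℝ}
    (hb : b < σ₁) (h : ∀ u ∈ Set.Ioo b σ₁, ‖deriv G (u + t * I)‖ ≤ K * ‖G (u + t * I)‖) :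
    ‖deriv G (b + t * I)‖ ≤ K * ‖G (b + t * I)‖ := by
  have hφ : Continuous fun u : ℝ ↦ ((u : ℂ) + t * I) := by fun_prop
  have hGc : Continuous G := hG.continuous
  have hG'c : Continuous (deriv G) := by
    have : ∀ z, AnalyticAt ℂ G z := fun z ↦ hG.analyticAt z
    exact continuous_iff_continuousAt.2 fun z ↦ (this z).deriv.continuousAt
  have hf : Continuous fun u : ℝ ↦ ‖deriv G (u + t * I)‖ := (hG'c.comp hφ).norm
  have hg : Continuous fun u : ℝ ↦ K * ‖G (u + t * I)‖ := continuous_const.mul (hGc.comp hφ).norm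
  have hmem : b ∈ closure (Set.Ioo b σ₁) := by
    rw [closure_Ioo hb.ne]; exact Set.left_mem_Icc.2 hb.le
  exact ContinuousWithinAt.closure_le hmem hf.continuousWithinAt hg.continuousWithinAt h


/-! ## MV Theorem 11.4, sharp form: `L'/L(s, χ) − [1/(s − β₁)] ≪ log qτ` -/

set_option maxHeartbeats 1600000 in
/-- **The heart of Montgomery–Vaughan Theorem 11.4** ((11.5) and (11.8) combined, proof
pp. 277–278), for one character with all absolute inputs as hypotheses: let `χ ≠ χ₀` mod `q`,
`c ≤ min(c₀/4, 1/40)` where `c₀` is a zero-free-region constant for `L(s, χ)` (zeros with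
`β > 1 − c₀/(log q + log(|γ|+4))` are real), let `P` be the set of real zeros
`β > 1 − 2c/(log q + log 4)` (at most one, each simple), and let
`s = σ + it` with `σ ≥ 1 − c/ℒ`, `ℒ = log q + log(|t| + 4)`, `s ∉ P`. Then `L(s, χ) ≠ 0` and
`‖L'/L(s, χ) − ∑_{β ∈ P} 1/(s − β)‖ ≤ C(c, K₀, E) · ℒ`.
Proof as in the source: with the Lemma-α package at height `t` and `s₁ = 1 + 1/(8ℒ) + it`,
`L'/L(s) = ψ(s) + ∑_{a ∈ S} m(a)/(s − a)`; every `a ∈ S` at distance `≥ c/ℒ` from `s` satisfies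
`|1/(s−a) − 1/(s₁−a)| ≪ Re 1/(s₁−a)` ((11.12)–(11.13)) and `∑ m(a) Re 1/(s₁−a) ≤ |L'/L(s₁)| + |ψ(s₁)| ≪ ℒ`
((11.11)); a zero of `S` closer than `c/ℒ` to `s` is real and in `P`, hence is the exceptional
`β`, lies in the disc, and has weight `m(β) = 1`, so that its term is exactly the subtracted
`1/(s − β)` (and `|1/(s₁ − β)| ≤ 8ℒ`). [cite: MontgomeryVaughan2007, Theorem 11.4 (11.5) and (11.8)] -/
theorem norm_logDeriv_sub_polar_le_aux {c₀ K₀ E c : ℝ} (hK₀ : 0 ≤ K₀) (hE : 0 ≤ E)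
    (hcpos : 0 < c) (hc4 : c ≤ c₀ / 4) (hc40 : c ≤ 1 / 40)
    (hKχ : ∀ (q : ℕ) [NeZero q] (χ : DirichletCharacter ℂ q) (s : ℂ), 1 < s.re →
        ‖deriv χ.LFunction s / χ.LFunction s‖ ≤ 1 / (min s.re 2 - 1) + K₀)
    {q : ℕ} [NeZero q] (χ : DirichletCharacter ℂ q) (hχ : χ ≠ 1)
    (hzf : ∀ ρ : ℂ, χ.LFunction ρ = 0 →
        1 - c₀ / (Real.log q + Real.log (|ρ.im| + 4)) < ρ.re → ρ.im = 0)
    (hpackage : ∀ t : ℝ, ∃ (S : Finset ℂ) (m : ℂ → ℕ) (ψ : ℂ → ℂ),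
        (∀ a ∈ S, χ.LFunction a = 0 ∧ 0 < m a ∧ ‖a - (17 / 16 + t * I)‖ ≤ 13 / 32) ∧
        (∀ a, χ.LFunction a = 0 → ‖a - (17 / 16 + t * I)‖ ≤ 13 / 32 → a ∈ S) ∧
        DifferentiableOn ℂ ψ (ball (17 / 16 + t * I) (13 / 32)) ∧
        (∀ z ∈ ball (17 / 16 + t * I) (13 / 32), χ.LFunction z ≠ 0 →
          ψ z = deriv χ.LFunction z / χ.LFunction z - ∑ a ∈ S, (m a : ℂ) / (z - a)) ∧
        (∀ z ∈ closedBall (17 / 16 + t * I) (13 / 128),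
          ‖ψ z‖ ≤ E * (Real.log q + Real.log (|t| + 4))))
    (hsimple : ∀ β : ℝ, χ.LFunction β = 0 → 1 - 2 * c / (Real.log q + Real.log 4) < β →
        deriv χ.LFunction β ≠ 0)
    (P : Finset ℝ)
    (hP : ∀ β : ℝ, β ∈ P ↔ χ.LFunction β = 0 ∧ 1 - 2 * c / (Real.log q + Real.log 4) < β)
    (hcard : P.card ≤ 1) {s : ℂ}
    (hregion : 1 - c / (Real.log q + Real.log (|s.im| + 4)) ≤ s.re) (hsP : ∀ β ∈ P, s ≠ β) :
    χ.LFunction s ≠ 0 ∧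
      ‖deriv χ.LFunction s / χ.LFunction s - ∑ β ∈ P, 1 / (s - (β : ℂ))‖ ≤
        (E + 2 * (1 / (8 * c) + 2) * (8 + K₀ + E) + (8 + K₀ + E) + 1 / c + 16 + K₀) *
          (Real.log q + Real.log (|s.im| + 4)) := by
  classical
  -- constants
  set U : ℝ := 8 + K₀ + E with hU
  have hU0 : 0 ≤ U := by rw [hU]; positivity
  set Kc : ℝ := 2 * (1 / (8 * c) + 2) with hKc
  have hKc0 : 0 ≤ Kc := by rw [hKc]; positivity
  have hKcU : 0 ≤ Kc * U := mul_nonneg hKc0 hU0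
  have h1c : 0 < 1 / c := by positivity
  set C : ℝ := E + Kc * U + U + 1 / c + 16 + K₀ with hCdef
  -- coordinates
  obtain ⟨σ, hσdef⟩ : ∃ σ : ℝ, s.re = σ := ⟨_, rfl⟩
  obtain ⟨t, htdef⟩ : ∃ t : ℝ, s.im = t := ⟨_, rfl⟩
  have hs : s = σ + t * I := by
    rw [← hσdef, ← htdef]; exact (Complex.re_add_im s).symm.trans (by simp [mul_comm])
  rw [hσdef, htdef] at hregion
  rw [htdef]
  have hlogq : 0 ≤ Real.log q := Real.log_natCast_nonneg q
  have hlog4 : 1 ≤ Real.log 4 := by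
    have := ClassicalZFRData.one_le_log_tau 0
    rwa [abs_zero, zero_add] at this
  have hlogτ : 1 ≤ Real.log (|t| + 4) := ClassicalZFRData.one_le_log_tau t
  have hlog4τ : Real.log 4 ≤ Real.log (|t| + 4) :=
    Real.log_le_log (by norm_num) (by linarith [abs_nonneg t])
  set ℒ : ℝ := Real.log q + Real.log (|t| + 4) with hℒ
  set ℒ₀ : ℝ := Real.log q + Real.log 4 with hℒ₀
  have hℒ1 : 1 ≤ ℒ := one_le_ell q t
  have hℒ0 : 0 < ℒ := by linarith
  have hℒ₀1 : 1 ≤ ℒ₀ := by rw [hℒ₀]; linarith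
  have hℒ₀0 : 0 < ℒ₀ := by linarith
  have hℒ₀ℒ : ℒ₀ ≤ ℒ := by rw [hℒ₀, hℒ]; linarith
  clear_value ℒ ℒ₀
  have hc₀4 : 4 * c ≤ c₀ := by linarith
  have hcℒ : c / ℒ ≤ c := div_le_self hcpos.le hℒ1
  have hcℒ40 : c / ℒ ≤ 1 / 40 := hcℒ.trans hc40
  have hcℒpos : 0 < c / ℒ := div_pos hcpos hℒ0
  have h2c : 2 * c / ℒ = 2 * (c / ℒ) := by ring
  -- zeros right of `1 − 2c/ℒ` at nearby heights are real and belong to `P`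
  have hreal : ∀ a : ℂ, χ.LFunction a = 0 → |a.im| ≤ |t| + 1 → 1 - 2 * c / ℒ < a.re →
      a.im = 0 ∧ a.re ∈ P ∧ a = ((a.re : ℝ) : ℂ) := by
    intro a hLa haim hare
    have hℒa := ell_le_of_abs_le q haim
    have hℒa0 : 0 < Real.log q + Real.log (|a.im| + 4) := ell_pos q a.im
    have h1 : c₀ / ℒ * (4 / 5) ≤ c₀ / (Real.log q + Real.log (|a.im| + 4)) := by
      rw [div_mul_eq_mul_div, div_le_div_iff₀ (by positivity) hℒa0]
      have hc₀0 : 0 ≤ c₀ := by linarith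
      nlinarith
    have h2 : 2 * c / ℒ ≤ c₀ / ℒ * (4 / 5) := by
      rw [div_mul_eq_mul_div, div_le_div_iff₀ hℒ0 (by positivity)]
      have : 2 * c ≤ c₀ * 4 / 5 := by linarith
      nlinarith
    have hzone : 1 - c₀ / (Real.log q + Real.log (|a.im| + 4)) < a.re := by linarith
    have him : a.im = 0 := hzf a hLa hzone
    have haeq : a = ((a.re : ℝ) : ℂ) := Complex.ext (by simp) (by simp [him])
    have h3 : 2 * c / ℒ ≤ 2 * c / ℒ₀ :=
      div_le_div_of_nonneg_left (by positivity) hℒ₀0 hℒ₀ℒ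
    refine ⟨him, (hP a.re).2 ⟨?_, by linarith⟩, haeq⟩
    rw [← haeq]; exact hLa
  -- `L(s, χ) ≠ 0`
  have hLs : χ.LFunction s ≠ 0 := by
    intro hLs
    have him : |s.im| ≤ |t| + 1 := by rw [htdef]; linarith [abs_nonneg t]
    have hre : 1 - 2 * c / ℒ < s.re := by rw [hσdef]; linarith
    obtain ⟨-, hmem, hseq⟩ := hreal _ hLs him hre
    exact hsP _ hmem hseq
  refine ⟨hLs, ?_⟩
  -- the elements of `P` are `< 1`, and at most one
  have hPlt : ∀ β ∈ P, β < 1 := by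
    intro β hβ
    have hLβ := ((hP β).1 hβ).1
    by_contra hcon
    exact DirichletCharacter.LFunction_ne_zero_of_one_le_re χ (Or.inl hχ)
      (s := β) (by simpa using not_lt.1 hcon) hLβ
  have hPuniq : ∀ β ∈ P, ∀ β' ∈ P, β = β' := Finset.card_le_one.1 hcard
  -- the auxiliary abscissa `σ₁ = 1 + 1/(8ℒ)`
  have hκ : 0 < 1 / (8 * ℒ) := by positivity
  have hκ1 : 1 / (8 * ℒ) ≤ 1 / 8 := by
    rw [div_le_div_iff₀ (by positivity) (by norm_num)]; linarith
  set σ₁ : ℝ := 1 + 1 / (8 * ℒ) with hσ₁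
  have hσ₁1 : 1 < σ₁ := by rw [hσ₁]; linarith
  have hσ₁2 : σ₁ ≤ 1 + 1 / 8 := by rw [hσ₁]; linarith
  have h8ℒ : 1 / (σ₁ - 1) = 8 * ℒ := by rw [hσ₁, add_sub_cancel_left, one_div_one_div]
  clear_value σ₁
  -- the polar terms for `σ ≥ σ₁`: `‖1/(s − β)‖ ≤ 8ℒ`
  have hpolar_easy : σ₁ ≤ σ → ‖∑ β ∈ P, 1 / (s - (β : ℂ))‖ ≤ 8 * ℒ := by
    intro hbig
    rcases P.eq_empty_or_nonempty with hPe | ⟨β, hβ⟩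
    · rw [hPe, Finset.sum_empty, norm_zero]; positivity
    · have hPeq : P = {β} := Finset.eq_singleton_iff_unique_mem.2 ⟨hβ, fun β' hβ' ↦ hPuniq β' hβ' β hβ⟩
      rw [hPeq, Finset.sum_singleton]
      have hβ1 := hPlt β hβ
      have hre : σ - β ≤ ‖s - (β : ℂ)‖ := by
        have := Complex.re_le_norm (s - (β : ℂ))
        simpa [hσdef] using this
      have hpos : 0 < σ - β := by linarith
      rw [norm_div, norm_one]
      calc 1 / ‖s - (β : ℂ)‖ ≤ 1 / (σ - β) := one_div_le_one_div_of_le hpos hre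
        _ ≤ 1 / (σ₁ - 1) := one_div_le_one_div_of_le (by linarith) (by linarith)
        _ = 8 * ℒ := h8ℒ
  have hK₀ℒ : K₀ ≤ K₀ * ℒ := by nlinarith
  have hCsplit : C * ℒ = (E + Kc * U + U + 1 / c) * ℒ + (16 + K₀) * ℒ := by rw [hCdef]; ring
  have hmainC : 0 ≤ (E + Kc * U + U + 1 / c) * ℒ := by positivity
  -- the easy case `σ ≥ σ₁`
  rcases le_or_gt σ₁ σ with hbig | hsmallσ
  · have h1 : 1 < s.re := by rw [hσdef]; linarith
    have h2 := hKχ q χ _ h1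
    rw [hσdef] at h2
    have h3 : 1 / (min σ 2 - 1) ≤ 8 * ℒ := by
      have hmin : 1 / (8 * ℒ) ≤ min σ 2 - 1 := by
        rw [le_sub_iff_add_le]
        exact le_min (by rw [hσ₁] at hbig; linarith) (by linarith)
      calc 1 / (min σ 2 - 1) ≤ 1 / (1 / (8 * ℒ)) := one_div_le_one_div_of_le hκ hmin
        _ = 8 * ℒ := one_div_one_div _
    have h4 := hpolar_easy hbig
    calc ‖deriv χ.LFunction s / χ.LFunction s - ∑ β ∈ P, 1 / (s - (β : ℂ))‖
        ≤ ‖deriv χ.LFunction s / χ.LFunction s‖ + ‖∑ β ∈ P, 1 / (s - (β : ℂ))‖ := norm_sub_le _ _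
      _ ≤ (8 * ℒ + K₀) + 8 * ℒ := add_le_add (h2.trans (by linarith)) h4
      _ ≤ (16 + K₀) * ℒ := by linarith
      _ ≤ C * ℒ := by rw [hCsplit]; linarith
  -- the main case `1 − c/ℒ ≤ σ < σ₁`
  obtain ⟨S, m, ψ, hS, hS', hψd, hψ, hψb⟩ := hpackage t
  rw [← hℒ] at hψb
  obtain ⟨cc, hccdef⟩ : ∃ cc : ℂ, cc = 17 / 16 + t * I := ⟨_, rfl⟩
  rw [← hccdef] at hS hS' hψd hψ hψb
  have hccim : cc.im = t := by rw [hccdef]; simp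
  have hσlow : 1 - 1 / 40 ≤ σ := by linarith only [hcℒ40, hregion]
  have hsc : ‖s - cc‖ ≤ 13 / 128 := by
    have : s - cc = ((σ - 17 / 16 : ℝ) : ℂ) := by rw [hs, hccdef]; push_cast; ring
    rw [this, Complex.norm_real, Real.norm_eq_abs]
    exact abs_le.2 ⟨by linarith only [hσlow], by linarith only [hsmallσ, hσ₁2]⟩
  have hsball : s ∈ ball cc (13 / 32) := mem_ball_iff_norm.2 (by linarith only [hsc])
  have hscl : s ∈ closedBall cc (13 / 128) := mem_closedBall_iff_norm.2 hsc
  have hψs := hψ _ hsball hLs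
  obtain ⟨s₁, hs₁⟩ : ∃ s₁ : ℂ, s₁ = (σ₁ : ℂ) + t * I := ⟨_, rfl⟩
  have hs₁re : s₁.re = σ₁ := by simp [hs₁]
  have hs₁im : s₁.im = t := by simp [hs₁]
  have hs₁1 : 1 < s₁.re := by rw [hs₁re]; exact hσ₁1
  have hs₁c : ‖s₁ - cc‖ ≤ 13 / 128 := by
    have : s₁ - cc = ((σ₁ - 17 / 16 : ℝ) : ℂ) := by
      simp only [hs₁, hccdef]; push_cast; ring
    rw [this, Complex.norm_real, Real.norm_eq_abs]
    exact abs_le.2 ⟨by linarith only [hσ₁1], by linarith only [hσ₁2]⟩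
  have hs₁ball : s₁ ∈ ball cc (13 / 32) := mem_ball_iff_norm.2 (by linarith only [hs₁c])
  have hs₁cl : s₁ ∈ closedBall cc (13 / 128) := mem_closedBall_iff_norm.2 hs₁c
  have hL₁ : χ.LFunction s₁ ≠ 0 :=
    DirichletCharacter.LFunction_ne_zero_of_one_le_re χ (Or.inl hχ) hs₁1.le
  have hψ₁ := hψ s₁ hs₁ball hL₁
  have hss₁ : ‖s₁ - s‖ ≤ 1 / (8 * ℒ) + c / ℒ := by
    have : s₁ - s = ((σ₁ - σ : ℝ) : ℂ) := by rw [hs, hs₁]; push_cast; ring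
    rw [this, Complex.norm_real, Real.norm_eq_abs, abs_of_nonneg (by linarith only [hsmallσ])]
    rw [hσ₁]; linarith only [hregion]
  -- facts about the zeros in `S`
  have hSre : ∀ a ∈ S, a.re < 1 := by
    intro a ha
    by_contra hcon
    exact DirichletCharacter.LFunction_ne_zero_of_one_le_re χ (Or.inl hχ) (not_lt.1 hcon) (hS a ha).1
  have hSre₁ : ∀ a ∈ S, 1 / (8 * ℒ) ≤ (s₁ - a).re := by
    intro a ha
    rw [Complex.sub_re, hs₁re, hσ₁]
    have := hSre a ha
    linarith only [this]
  have hterm_re : ∀ a ∈ S, ((m a : ℂ) / (s₁ - a)).re = (m a : ℝ) * ((s₁ - a)⁻¹).re := by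
    intro a _
    rw [div_eq_mul_inv, show ((m a : ℕ) : ℂ) = ((m a : ℝ) : ℂ) by simp, Complex.re_ofReal_mul]
  have hinv_nn : ∀ a ∈ S, 0 ≤ ((s₁ - a)⁻¹).re := by
    intro a ha
    rw [Complex.inv_re]
    exact div_nonneg (hκ.le.trans (hSre₁ a ha)) (Complex.normSq_nonneg _)
  have hterm_nn : ∀ a ∈ S, 0 ≤ (m a : ℝ) * ((s₁ - a)⁻¹).re := fun a ha ↦
    mul_nonneg (Nat.cast_nonneg _) (hinv_nn a ha)
  have hsumre_eq : (∑ a ∈ S, (m a : ℂ) / (s₁ - a)).re = ∑ a ∈ S, (m a : ℝ) * ((s₁ - a)⁻¹).re := by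
    rw [Complex.re_sum]; exact Finset.sum_congr rfl hterm_re
  -- (1) `‖∑ m(a)/(s₁ − a)‖ ≤ Uℒ` (MV (11.11))
  have hL'₁ : ‖deriv χ.LFunction s₁ / χ.LFunction s₁‖ ≤ 8 * ℒ + K₀ := by
    have := hKχ q χ s₁ hs₁1
    have hσ₁le2 : σ₁ ≤ 2 := by linarith
    have hmin : min s₁.re 2 = σ₁ := by rw [hs₁re]; exact min_eq_left hσ₁le2
    rw [hmin, h8ℒ] at this
    exact this
  have hsum₁eq : ∑ a ∈ S, (m a : ℂ) / (s₁ - a) = deriv χ.LFunction s₁ / χ.LFunction s₁ - ψ s₁ := by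
    rw [hψ₁]; ring
  have hsum₁ : ‖∑ a ∈ S, (m a : ℂ) / (s₁ - a)‖ ≤ U * ℒ := by
    rw [hsum₁eq]
    have h1 := norm_sub_le (deriv χ.LFunction s₁ / χ.LFunction s₁) (ψ s₁)
    have h2 := hψb s₁ hs₁cl
    have h3 : (8 * ℒ + K₀) + E * ℒ ≤ U * ℒ := by rw [hU]; linear_combination hK₀ℒ
    linarith
  have hsum₁re : ∑ a ∈ S, (m a : ℝ) * ((s₁ - a)⁻¹).re ≤ U * ℒ := by
    rw [← hsumre_eq]; exact (Complex.re_le_norm _).trans hsum₁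
  -- (2) zeros at distance `≥ c/ℒ` from `s`: the comparison (11.12)–(11.13)
  have hKc_ge : (1 / (8 * ℒ) + c / ℒ) / (1 / (8 * ℒ)) * ((1 / (8 * ℒ) + c / ℒ) / (c / ℒ) + 1) ≤ Kc := by
    have e1 : (1 / (8 * ℒ) + c / ℒ) / (1 / (8 * ℒ)) = 1 + 8 * c := by field_simp
    have e2 : (1 / (8 * ℒ) + c / ℒ) / (c / ℒ) = 1 / (8 * c) + 1 := by field_simp
    rw [e1, e2]
    have h1 : 1 + 8 * c ≤ 2 := by linarith
    have h0 : 0 ≤ 1 / (8 * c) + 1 + 1 := by positivity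
    calc (1 + 8 * c) * (1 / (8 * c) + 1 + 1) ≤ 2 * (1 / (8 * c) + 1 + 1) :=
          mul_le_mul_of_nonneg_right h1 h0
      _ = Kc := by rw [hKc]; ring
  have hfar : ∀ a ∈ S, c / ℒ ≤ ‖s - a‖ → ‖(s - a)⁻¹ - (s₁ - a)⁻¹‖ ≤ Kc * ((s₁ - a)⁻¹).re := by
    intro a haS hda
    have hw : s₁.re - s.re ≤ 1 / (8 * ℒ) + c / ℒ := by
      rw [hs₁re, hσdef, hσ₁]; linarith
    have hκκ : 1 / (8 * ℒ) ≤ s₁.re - a.re := by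
      have := hSre₁ a haS; simpa only [Complex.sub_re] using this
    have hσσ₁ : s.re ≤ s₁.re := by rw [hσdef, hs₁re]; exact hsmallσ.le
    have h := norm_inv_sub_inv_le_of_norm (s := s) (s₁ := s₁) (a := a)
      (w := 1 / (8 * ℒ) + c / ℒ) (d := c / ℒ) (κ := 1 / (8 * ℒ)) hcℒpos hκ
      (by rw [htdef, hs₁im]) hσσ₁ hw hda hκκ
    exact h.trans (mul_le_mul_of_nonneg_right hKc_ge (hinv_nn a haS))
  have hfar_sum : ∀ T : Finset ℂ, T ⊆ S → (∀ a ∈ T, c / ℒ ≤ ‖s - a‖) →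
      ‖∑ a ∈ T, (m a : ℂ) * ((s - a)⁻¹ - (s₁ - a)⁻¹)‖ ≤ Kc * (U * ℒ) := by
    intro T hTS hT
    calc ‖∑ a ∈ T, (m a : ℂ) * ((s - a)⁻¹ - (s₁ - a)⁻¹)‖
        ≤ ∑ a ∈ T, ‖(m a : ℂ) * ((s - a)⁻¹ - (s₁ - a)⁻¹)‖ := norm_sum_le _ _
      _ = ∑ a ∈ T, (m a : ℝ) * ‖(s - a)⁻¹ - (s₁ - a)⁻¹‖ :=
          Finset.sum_congr rfl fun a _ ↦ by rw [norm_mul, Complex.norm_natCast]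
      _ ≤ ∑ a ∈ T, (m a : ℝ) * (Kc * ((s₁ - a)⁻¹).re) :=
          Finset.sum_le_sum fun a ha ↦
            mul_le_mul_of_nonneg_left (hfar a (hTS ha) (hT a ha)) (Nat.cast_nonneg _)
      _ = Kc * ∑ a ∈ T, (m a : ℝ) * ((s₁ - a)⁻¹).re := by
          rw [Finset.mul_sum]; exact Finset.sum_congr rfl fun a _ ↦ by ring
      _ ≤ Kc * ∑ a ∈ S, (m a : ℝ) * ((s₁ - a)⁻¹).re := by
          refine mul_le_mul_of_nonneg_left ?_ hKc0
          exact Finset.sum_le_sum_of_subset_of_nonneg hTS (fun a ha _ ↦ hterm_nn a ha)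
      _ ≤ Kc * (U * ℒ) := mul_le_mul_of_nonneg_left hsum₁re hKc0
  -- (3) a zero of `S` closer than `c/ℒ` to `s` is real and in `P`
  have hclose : ∀ a ∈ S, ‖s - a‖ < c / ℒ → a.re ∈ P ∧ a = ((a.re : ℝ) : ℂ) := by
    intro a haS hda
    have him : |(s - a).im| ≤ ‖s - a‖ := Complex.abs_im_le_norm _
    have hre : |(s - a).re| ≤ ‖s - a‖ := Complex.abs_re_le_norm _
    rw [Complex.sub_im, htdef] at him
    rw [Complex.sub_re, hσdef] at hre
    have h1 : |a.im| ≤ |t| + 1 := by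
      have := abs_sub_abs_le_abs_sub a.im t
      rw [abs_sub_comm] at this
      linarith [hcℒ.trans hc40]
    have h2 : 1 - 2 * c / ℒ < a.re := by
      have := le_abs_self (σ - a.re)
      rw [h2c]; linarith
    obtain ⟨-, hmem, haeq⟩ := hreal a (hS a haS).1 h1 h2
    exact ⟨hmem, haeq⟩
  -- the splitting `L'/L(s) = ψ(s) + ∑_S`, with `‖ψ(s)‖ ≤ Eℒ`
  have hEq : deriv χ.LFunction s / χ.LFunction s = ψ s + ∑ a ∈ S, (m a : ℂ) / (s - a) := by
    rw [hψs]; ring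
  have hψs_b := hψb s hscl
  have hsplit : ∀ T : Finset ℂ, ∑ a ∈ T, (m a : ℂ) / (s - a) =
      ∑ a ∈ T, (m a : ℂ) * ((s - a)⁻¹ - (s₁ - a)⁻¹) + ∑ a ∈ T, (m a : ℂ) / (s₁ - a) := by
    intro T
    rw [← Finset.sum_add_distrib]
    exact Finset.sum_congr rfl fun a _ ↦ by ring
  -- the bound when all zeros of `S` are at distance `≥ c/ℒ`
  have hallfar : (∀ a ∈ S, c / ℒ ≤ ‖s - a‖) →
      ‖deriv χ.LFunction s / χ.LFunction s‖ ≤ (E + Kc * U + U) * ℒ := by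
    intro hall
    rw [hEq, hsplit S]
    have h1 := hfar_sum S (Finset.Subset.refl _) hall
    calc ‖ψ s + (∑ a ∈ S, (m a : ℂ) * ((s - a)⁻¹ - (s₁ - a)⁻¹) + ∑ a ∈ S, (m a : ℂ) / (s₁ - a))‖
        ≤ ‖ψ s‖ + (‖∑ a ∈ S, (m a : ℂ) * ((s - a)⁻¹ - (s₁ - a)⁻¹)‖ +
            ‖∑ a ∈ S, (m a : ℂ) / (s₁ - a)‖) :=
          (norm_add_le _ _).trans (add_le_add le_rfl (norm_add_le _ _))
      _ ≤ E * ℒ + (Kc * (U * ℒ) + U * ℒ) := add_le_add hψs_b (add_le_add h1 hsum₁)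
      _ = (E + Kc * U + U) * ℒ := by ring
  rcases P.eq_empty_or_nonempty with hPe | ⟨β, hβ⟩
  · -- no exceptional zero: every zero of `S` is far
    have hall : ∀ a ∈ S, c / ℒ ≤ ‖s - a‖ := by
      intro a ha
      by_contra hcon
      have := (hclose a ha (not_le.1 hcon)).1
      rw [hPe] at this
      exact Finset.notMem_empty _ this
    rw [hPe, Finset.sum_empty, sub_zero]
    calc ‖deriv χ.LFunction s / χ.LFunction s‖ ≤ (E + Kc * U + U) * ℒ := hallfar hall
      _ ≤ C * ℒ := by rw [hCsplit]; nlinarith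
  · -- one exceptional zero `β`
    have hPeq : P = {β} :=
      Finset.eq_singleton_iff_unique_mem.2 ⟨hβ, fun β' hβ' ↦ hPuniq β' hβ' β hβ⟩
    have hLβ := ((hP β).1 hβ).1
    have hβc := ((hP β).1 hβ).2
    have hβ1 := hPlt β hβ
    have hsβ : s ≠ (β : ℂ) := hsP β hβ
    rw [hPeq, Finset.sum_singleton]
    rcases le_or_gt (c / ℒ) ‖s - (β : ℂ)‖ with hβfar | hβnear
    · -- `β` is far from `s`: all zeros of `S` are far, and `‖1/(s − β)‖ ≤ ℒ/c`
      have hall : ∀ a ∈ S, c / ℒ ≤ ‖s - a‖ := by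
        intro a ha
        by_contra hcon
        obtain ⟨hmem, haeq⟩ := hclose a ha (not_le.1 hcon)
        rw [hPeq, Finset.mem_singleton] at hmem
        rw [haeq, hmem] at hcon
        exact hcon hβfar
      have hpol : ‖1 / (s - (β : ℂ))‖ ≤ 1 / c * ℒ := by
        rw [norm_div, norm_one]
        calc 1 / ‖s - (β : ℂ)‖ ≤ 1 / (c / ℒ) := one_div_le_one_div_of_le hcℒpos hβfar
          _ = 1 / c * ℒ := by field_simp
      calc ‖deriv χ.LFunction s / χ.LFunction s - 1 / (s - (β : ℂ))‖
          ≤ ‖deriv χ.LFunction s / χ.LFunction s‖ + ‖1 / (s - (β : ℂ))‖ := norm_sub_le _ _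
        _ ≤ (E + Kc * U + U) * ℒ + 1 / c * ℒ := add_le_add (hallfar hall) hpol
        _ ≤ C * ℒ := by rw [hCsplit]; nlinarith
    · -- `β` is within `c/ℒ` of `s`: it lies in the disc, with weight `1`
      have hβcc : ‖(β : ℂ) - cc‖ < 13 / 32 := by
        calc ‖(β : ℂ) - cc‖ = ‖((β : ℂ) - s) + (s - cc)‖ := by ring_nf
          _ ≤ ‖(β : ℂ) - s‖ + ‖s - cc‖ := norm_add_le _ _
          _ < c / ℒ + 13 / 128 := by
              rw [norm_sub_rev]; exact add_lt_add_of_lt_of_le hβnear hsc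
          _ ≤ 13 / 32 := by linarith
      have hβS : (β : ℂ) ∈ S := hS' _ hLβ hβcc.le
      have hβball : (β : ℂ) ∈ ball cc (13 / 32) := mem_ball_iff_norm.2 hβcc
      have hmβ : m (β : ℂ) = 1 := mult_eq_one χ hχ hψd hψ hβS hβball hLβ (hsimple β hLβ hβc)
      -- the other zeros of `S` are far
      have hall : ∀ a ∈ S.erase (β : ℂ), c / ℒ ≤ ‖s - a‖ := by
        intro a ha
        obtain ⟨hane, haS⟩ := Finset.mem_erase.1 ha
        by_contra hcon
        obtain ⟨hmem, haeq⟩ := hclose a haS (not_le.1 hcon)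
        rw [hPeq, Finset.mem_singleton] at hmem
        rw [hmem] at haeq
        exact hane haeq
      -- `∑_S m(a)/(s − a) = ∑_{S ∖ β} + 1/(s − β)`, and the same at `s₁`
      have hsumS : ∑ a ∈ S, (m a : ℂ) / (s - a) =
          ∑ a ∈ S.erase (β : ℂ), (m a : ℂ) / (s - a) + 1 / (s - (β : ℂ)) := by
        rw [← Finset.sum_erase_add S _ hβS, hmβ, Nat.cast_one]
      have hsumS₁ : ∑ a ∈ S.erase (β : ℂ), (m a : ℂ) / (s₁ - a) =
          ∑ a ∈ S, (m a : ℂ) / (s₁ - a) - 1 / (s₁ - (β : ℂ)) := by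
        rw [← Finset.sum_erase_add S _ hβS, hmβ, Nat.cast_one]; ring
      have hpol₁ : ‖1 / (s₁ - (β : ℂ))‖ ≤ 8 * ℒ := by
        have hre : σ₁ - β ≤ ‖s₁ - (β : ℂ)‖ := by
          have := Complex.re_le_norm (s₁ - (β : ℂ))
          simpa [hs₁re] using this
        have hpos : 0 < σ₁ - β := by linarith
        rw [norm_div, norm_one]
        calc 1 / ‖s₁ - (β : ℂ)‖ ≤ 1 / (σ₁ - β) := one_div_le_one_div_of_le hpos hre
          _ ≤ 1 / (σ₁ - 1) := one_div_le_one_div_of_le (by linarith) (by linarith)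
          _ = 8 * ℒ := h8ℒ
      have hEq' : deriv χ.LFunction s / χ.LFunction s - 1 / (s - (β : ℂ)) =
          ψ s + (∑ a ∈ S.erase (β : ℂ), (m a : ℂ) * ((s - a)⁻¹ - (s₁ - a)⁻¹) +
            (∑ a ∈ S, (m a : ℂ) / (s₁ - a) - 1 / (s₁ - (β : ℂ)))) := by
        rw [hEq, hsumS, hsplit (S.erase (β : ℂ)), hsumS₁]; ring
      have h1 := hfar_sum (S.erase (β : ℂ)) (Finset.erase_subset _ _) hall
      rw [hEq']
      calc ‖ψ s + (∑ a ∈ S.erase (β : ℂ), (m a : ℂ) * ((s - a)⁻¹ - (s₁ - a)⁻¹) +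
              (∑ a ∈ S, (m a : ℂ) / (s₁ - a) - 1 / (s₁ - (β : ℂ))))‖
          ≤ ‖ψ s‖ + (‖∑ a ∈ S.erase (β : ℂ), (m a : ℂ) * ((s - a)⁻¹ - (s₁ - a)⁻¹)‖ +
              (‖∑ a ∈ S, (m a : ℂ) / (s₁ - a)‖ + ‖1 / (s₁ - (β : ℂ))‖)) :=
            (norm_add_le _ _).trans (add_le_add le_rfl
              ((norm_add_le _ _).trans (add_le_add le_rfl (norm_sub_le _ _))))
        _ ≤ E * ℒ + (Kc * (U * ℒ) + (U * ℒ + 8 * ℒ)) :=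
            add_le_add hψs_b (add_le_add h1 (add_le_add hsum₁ hpol₁))
        _ ≤ C * ℒ := by rw [hCsplit]; nlinarith


/-- **Montgomery–Vaughan Theorem 11.4, (11.5) and (11.8), sharp form.** There are absolute
constants `0 < c ≤ 1/40` and `C ≥ 0` such that for every `q ≥ 1` and every non-principal `χ`
mod `q`, writing `ℒ = log q + log(|t| + 4)`, `ℒ₀ = log q + log 4`:
(zfr) every zero `ρ` of `L(s, χ)` with `Re ρ > 1 − 2c/ℒ_ρ` is real and `χ` is quadratic
(MV Theorem 11.3); (unique) there is at most one real zero `β > 1 − 2c/ℒ₀` (Theorem 11.3,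
Case 4 / Landau–Page), and (simple) it is a simple zero; (i) if there is no such zero then
`L(s, χ) ≠ 0` and `‖L'/L(s, χ)‖ ≤ C ℒ` for `σ ≥ 1 − c/ℒ` — this is (11.5); (ii) if `β` is such a
zero then for `σ ≥ 1 − c/ℒ`, `s ≠ β`: `L(s, χ) ≠ 0` and `‖L'/L(s, χ) − 1/(s − β)‖ ≤ C ℒ` — this
is (11.8) (stated there for `|s − β₁| ≤ 1/log q`, with `O(log q)`; for `|s − β₁| ≥ 1/log q` it is
(11.5) again since then `|1/(s − β₁)| ≤ log q`).
[cite: MontgomeryVaughan2007, Theorem 11.4 (11.5) and (11.8)] -/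
theorem exists_norm_logDeriv_sub_polar_le :
    ∃ c : ℝ, 0 < c ∧ c ≤ 1 / 40 ∧ ∃ C : ℝ, 0 ≤ C ∧
      (∀ (q : ℕ) [NeZero q] (χ : DirichletCharacter ℂ q), χ ≠ 1 → ∀ ρ : ℂ, χ.LFunction ρ = 0 →
        1 - 2 * c / (Real.log q + Real.log (|ρ.im| + 4)) < ρ.re → χ ^ 2 = 1 ∧ ρ.im = 0) ∧
      (∀ (q : ℕ) [NeZero q] (χ : DirichletCharacter ℂ q), χ ≠ 1 → ∀ β β' : ℝ,
        χ.LFunction β = 0 → χ.LFunction β' = 0 →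
        1 - 2 * c / (Real.log q + Real.log 4) < β → 1 - 2 * c / (Real.log q + Real.log 4) < β' →
        β = β') ∧
      (∀ (q : ℕ) [NeZero q] (χ : DirichletCharacter ℂ q), χ ≠ 1 → ∀ β : ℝ,
        χ.LFunction β = 0 → 1 - 2 * c / (Real.log q + Real.log 4) < β →
        deriv χ.LFunction β ≠ 0) ∧
      (∀ (q : ℕ) [NeZero q] (χ : DirichletCharacter ℂ q), χ ≠ 1 →
        (∀ β : ℝ, χ.LFunction β = 0 → β ≤ 1 - 2 * c / (Real.log q + Real.log 4)) →
        ∀ s : ℂ, 1 - c / (Real.log q + Real.log (|s.im| + 4)) ≤ s.re →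
          χ.LFunction s ≠ 0 ∧
          ‖deriv χ.LFunction s / χ.LFunction s‖ ≤ C * (Real.log q + Real.log (|s.im| + 4))) ∧
      (∀ (q : ℕ) [NeZero q] (χ : DirichletCharacter ℂ q), χ ≠ 1 → ∀ β : ℝ,
        χ.LFunction β = 0 → 1 - 2 * c / (Real.log q + Real.log 4) < β →
        ∀ s : ℂ, 1 - c / (Real.log q + Real.log (|s.im| + 4)) ≤ s.re → s ≠ β →
          χ.LFunction s ≠ 0 ∧
          ‖deriv χ.LFunction s / χ.LFunction s - 1 / (s - β)‖ ≤
            C * (Real.log q + Real.log (|s.im| + 4))) := by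
  classical
  obtain ⟨c₀, hc₀, hzf⟩ := exists_zeroFree
  obtain ⟨K₀, hK₀, -, hKχ⟩ := exists_norm_logDeriv_le
  obtain ⟨E, hE, hpackage⟩ := exists_logDeriv_package'
  obtain ⟨cP, hcP, hP⟩ := exists_min_realZeros_le
  obtain ⟨c₄, hc₄, hsimple⟩ := exists_deriv_ne_zero_of_realZero
  set c : ℝ := min (c₀ / 4) (min (1 / 40) (min (cP / 2) (c₄ / 2))) with hcdef
  have hc4 : c ≤ c₀ / 4 := min_le_left _ _
  have hc40 : c ≤ 1 / 40 := (min_le_right _ _).trans (min_le_left _ _)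
  have hcP2 : c ≤ cP / 2 := ((min_le_right _ _).trans (min_le_right _ _)).trans (min_le_left _ _)
  have hc42 : c ≤ c₄ / 2 := ((min_le_right _ _).trans (min_le_right _ _)).trans (min_le_right _ _)
  have hcpos : 0 < c :=
    lt_min (by positivity) (lt_min (by norm_num) (lt_min (by positivity) (by positivity)))
  clear_value c
  set C : ℝ := E + 2 * (1 / (8 * c) + 2) * (8 + K₀ + E) + (8 + K₀ + E) + 1 / c + 16 + K₀ with hCdef
  have hCpos : 0 ≤ C := by rw [hCdef]; positivity
  -- (zfr)
  have hzf2 : ∀ (q : ℕ) [NeZero q] (χ : DirichletCharacter ℂ q), χ ≠ 1 → ∀ ρ : ℂ,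
      χ.LFunction ρ = 0 → 1 - 2 * c / (Real.log q + Real.log (|ρ.im| + 4)) < ρ.re →
      χ ^ 2 = 1 ∧ ρ.im = 0 := by
    intro q _ χ hχ ρ hρ hre
    refine hzf q χ hχ ρ hρ (lt_of_le_of_lt ?_ hre)
    have hℒ := ell_pos q ρ.im
    have : 2 * c / (Real.log q + Real.log (|ρ.im| + 4)) ≤
        c₀ / (Real.log q + Real.log (|ρ.im| + 4)) :=
      div_le_div_of_nonneg_right (by linarith) hℒ.le
    linarith
  have hzf1 : ∀ (q : ℕ) [NeZero q] (χ : DirichletCharacter ℂ q), χ ≠ 1 → ∀ ρ : ℂ,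
      χ.LFunction ρ = 0 → 1 - c₀ / (Real.log q + Real.log (|ρ.im| + 4)) < ρ.re → ρ.im = 0 :=
    fun q _ χ hχ ρ hρ hre ↦ (hzf q χ hχ ρ hρ hre).2
  -- (unique)
  have huniq : ∀ (q : ℕ) [NeZero q] (χ : DirichletCharacter ℂ q), χ ≠ 1 → ∀ β β' : ℝ,
      χ.LFunction β = 0 → χ.LFunction β' = 0 →
      1 - 2 * c / (Real.log q + Real.log 4) < β → 1 - 2 * c / (Real.log q + Real.log 4) < β' →
      β = β' := by
    intro q _ χ hχ β β' hβ hβ' hβc hβ'c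
    by_contra hne
    have hmin := hP q χ hχ β β' hβ hβ' hne
    have hℒ₀ : 0 < Real.log q + Real.log 4 := one_pos.trans_le (PagePNT.one_le_ell0 q)
    have : 2 * c / (Real.log q + Real.log 4) ≤ cP / (Real.log q + Real.log 4) :=
      div_le_div_of_nonneg_right (by linarith) hℒ₀.le
    have hlt : 1 - 2 * c / (Real.log q + Real.log 4) < min β β' := lt_min hβc hβ'c
    linarith
  -- (simple)
  have hsimple2 : ∀ (q : ℕ) [NeZero q] (χ : DirichletCharacter ℂ q), χ ≠ 1 → ∀ β : ℝ,
      χ.LFunction β = 0 → 1 - 2 * c / (Real.log q + Real.log 4) < β →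
      deriv χ.LFunction β ≠ 0 := by
    intro q _ χ hχ β hβ hβc
    refine hsimple q χ hχ β hβ (lt_of_le_of_lt ?_ hβc)
    have hℒ₀ : 0 < Real.log q + Real.log 4 := one_pos.trans_le (PagePNT.one_le_ell0 q)
    have : 2 * c / (Real.log q + Real.log 4) ≤ c₄ / (Real.log q + Real.log 4) :=
      div_le_div_of_nonneg_right (by linarith) hℒ₀.le
    linarith
  refine ⟨c, hcpos, hc40, C, hCpos, hzf2, huniq, hsimple2, ?_, ?_⟩
  · intro q _ χ hχ hnone s hs
    have h := norm_logDeriv_sub_polar_le_aux (c₀ := c₀) hK₀ hE hcpos hc4 hc40 hKχ χ hχ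
      (hzf1 q χ hχ) (hpackage q χ hχ) (hsimple2 q χ hχ) ∅
      (fun β ↦ ⟨fun h ↦ (Finset.notMem_empty β h).elim,
        fun h ↦ absurd (hnone β h.1) (not_le.2 h.2)⟩)
      (by simp) hs (fun β h ↦ (Finset.notMem_empty β h).elim)
    simpa only [Finset.sum_empty, sub_zero] using h
  · intro q _ χ hχ β hβ hβc s hs hsβ
    have h := norm_logDeriv_sub_polar_le_aux (c₀ := c₀) hK₀ hE hcpos hc4 hc40 hKχ χ hχ
      (hzf1 q χ hχ) (hpackage q χ hχ) (hsimple2 q χ hχ) {β}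
      (fun β' ↦ ⟨fun h ↦ by rw [Finset.mem_singleton] at h; rw [h]; exact ⟨hβ, hβc⟩,
        fun h ↦ by rw [Finset.mem_singleton]; exact huniq q χ hχ β' β h.1 hβ h.2 hβc⟩)
      (by simp) hs (fun β' h ↦ by rw [Finset.mem_singleton] at h; rw [h]; exact hsβ)
    simpa only [Finset.sum_singleton] using h

/-! ## `1/L(s, χ) ≪ log qτ` (MV (11.7)) and `|s − β₁| ≪ |L(s, χ)|` (MV (11.10)) -/

/-- The trivial bound to the right: for `Re s ≥ 1 + 1/(8ℒ)` (`ℒ ≥ 1`),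
`‖1/L(s, χ)‖ ≤ σ/(σ − 1) ≤ 9ℒ`. [cite: MontgomeryVaughan2007, Theorem 11.4 (proof)] -/
theorem norm_inv_LFunction_le_right {q : ℕ} [NeZero q] (χ : DirichletCharacter ℂ q) {s : ℂ}
    {ℒ : ℝ} (hℒ : 1 ≤ ℒ) (hs : 1 + 1 / (8 * ℒ) ≤ s.re) :
    χ.LFunction s ≠ 0 ∧ ‖(χ.LFunction s)⁻¹‖ ≤ 9 * ℒ := by
  have hℒ0 : 0 < ℒ := by linarith
  have hκ : 0 < 1 / (8 * ℒ) := by positivity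
  have hs1 : 1 < s.re := by linarith
  have hlow := norm_LFunction_ge χ hs1
  have hpos : 0 < (s.re - 1) / s.re := div_pos (by linarith) (by linarith)
  have hne : χ.LFunction s ≠ 0 := by
    intro h; rw [h, norm_zero] at hlow; linarith
  refine ⟨hne, ?_⟩
  rw [norm_inv]
  calc ‖χ.LFunction s‖⁻¹ ≤ ((s.re - 1) / s.re)⁻¹ := inv_anti₀ hpos hlow
    _ = 1 + 1 / (s.re - 1) := by
        have hne : s.re - 1 ≠ 0 := by linarith
        rw [inv_div]; field_simp; ring
    _ ≤ 1 + 1 / (1 / (8 * ℒ)) := by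
        gcongr
        linarith
    _ = 1 + 8 * ℒ := by rw [one_div_one_div]
    _ ≤ 9 * ℒ := by linarith

set_option maxHeartbeats 800000 in
/-- **Montgomery–Vaughan Theorem 11.4, (11.7) and (11.10): bounds for `1/L(s, χ)`.** There are
absolute constants `0 < c ≤ 1/4` and `C ≥ 0` such that for every `q ≥ 1` and every
non-principal `χ` mod `q` (`ℒ = log q + log(|t| + 4)`, `ℒ₀ = log q + log 4`):
(zfr) every zero `ρ` of `L(s, χ)` with `Re ρ > 1 − 2c/ℒ_ρ` is real and `χ` is quadratic;
(unique) there is at most one real zero `β > 1 − 2c/ℒ₀`;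
(A) if `L(s, χ)` has no real zero `β > 1 − 2c/ℒ₀`, then `L(s, χ) ≠ 0` and
`‖1/L(s, χ)‖ ≤ C ℒ` for `σ ≥ 1 − c/ℒ` — this is (11.7);
(B) if `β > 1 − 2c/ℒ₀` is a real zero, then `L'(β, χ) ≠ 0` with `‖1/L'(β, χ)‖ ≤ C ℒ₀`, and for
`σ ≥ 1 − c/ℒ`, `s ≠ β`: `L(s, χ) ≠ 0` and `‖1/L(s, χ)‖ ≤ C ℒ (1 + 1/‖s − β‖)` — this contains
(11.10), `|s − β₁| ≪ |L(s, χ)|`, and (11.7) away from `β₁`.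
Proof: integrate the sharp bounds `exists_norm_logDeriv_sub_polar_le` for `L'/L` (case A) or
for `g'/g`, `g(s) = L(s, χ)/(s − β)` (case B), along `[σ, 1 + 1/(8ℒ)] + it` (Grönwall), starting
from `‖L(s₁, χ)‖ ≥ (σ₁ − 1)/σ₁` (MV: "`log L(s,χ) − log L(s₁,χ) = ∫ L'/L ≪ 1`").
[cite: MontgomeryVaughan2007, Theorem 11.4 (11.7) and (11.10)] -/
theorem exists_inv_LFunction_bounds :
    ∃ c : ℝ, 0 < c ∧ c ≤ 1 / 4 ∧ ∃ C : ℝ, 0 ≤ C ∧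
      (∀ (q : ℕ) [NeZero q] (χ : DirichletCharacter ℂ q), χ ≠ 1 → ∀ ρ : ℂ, χ.LFunction ρ = 0 →
        1 - 2 * c / (Real.log q + Real.log (|ρ.im| + 4)) < ρ.re → χ ^ 2 = 1 ∧ ρ.im = 0) ∧
      (∀ (q : ℕ) [NeZero q] (χ : DirichletCharacter ℂ q), χ ≠ 1 → ∀ β β' : ℝ,
        χ.LFunction β = 0 → χ.LFunction β' = 0 →
        1 - 2 * c / (Real.log q + Real.log 4) < β → 1 - 2 * c / (Real.log q + Real.log 4) < β' →
        β = β') ∧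
      (∀ (q : ℕ) [NeZero q] (χ : DirichletCharacter ℂ q), χ ≠ 1 →
        (∀ β : ℝ, χ.LFunction β = 0 → β ≤ 1 - 2 * c / (Real.log q + Real.log 4)) →
        ∀ s : ℂ, 1 - c / (Real.log q + Real.log (|s.im| + 4)) ≤ s.re →
          χ.LFunction s ≠ 0 ∧
          ‖(χ.LFunction s)⁻¹‖ ≤ C * (Real.log q + Real.log (|s.im| + 4))) ∧
      (∀ (q : ℕ) [NeZero q] (χ : DirichletCharacter ℂ q), χ ≠ 1 → ∀ β : ℝ,
        χ.LFunction β = 0 → 1 - 2 * c / (Real.log q + Real.log 4) < β →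
        deriv χ.LFunction β ≠ 0 ∧
        ‖(deriv χ.LFunction β)⁻¹‖ ≤ C * (Real.log q + Real.log 4) ∧
        ∀ s : ℂ, 1 - c / (Real.log q + Real.log (|s.im| + 4)) ≤ s.re → s ≠ β →
          χ.LFunction s ≠ 0 ∧
          ‖(χ.LFunction s)⁻¹‖ ≤
            C * (Real.log q + Real.log (|s.im| + 4)) * (1 + ‖s - β‖⁻¹)) := by
  obtain ⟨c, hcpos, hc40, C, hC0, hzf, huniq, hsimple, hA, hB⟩ :=
    exists_norm_logDeriv_sub_polar_le
  -- constants: `c' = c/2`, `K = C + 2/c`, `C' = 9 exp(K(1/8 + c))`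
  set K : ℝ := C + 2 / c with hKdef
  have hK0 : 0 ≤ K := by positivity
  set κ₀ : ℝ := K * (1 / 8 + c) with hκ₀
  set C' : ℝ := 9 * Real.exp κ₀ with hC'def
  have hexp1 : 1 ≤ Real.exp κ₀ := Real.one_le_exp (by positivity)
  have hC'9 : 9 ≤ C' := by rw [hC'def]; nlinarith
  have hC'0 : 0 ≤ C' := by linarith
  refine ⟨c / 2, by positivity, by linarith, C', hC'0, ?_, ?_, ?_, ?_⟩
  · -- (zfr) at `2c' = c`
    intro q _ χ hχ ρ hρ hre
    refine hzf q χ hχ ρ hρ (lt_of_le_of_lt ?_ hre)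
    have hℒ := ell_pos q ρ.im
    have : 2 * (c / 2) / (Real.log q + Real.log (|ρ.im| + 4)) ≤
        2 * c / (Real.log q + Real.log (|ρ.im| + 4)) :=
      div_le_div_of_nonneg_right (by linarith) hℒ.le
    linarith
  · -- (unique) at `2c' = c`
    intro q _ χ hχ β β' hβ hβ' hβc hβ'c
    have hℒ₀ : 0 < Real.log q + Real.log 4 := one_pos.trans_le (PagePNT.one_le_ell0 q)
    have : 2 * (c / 2) / (Real.log q + Real.log 4) ≤ 2 * c / (Real.log q + Real.log 4) :=
      div_le_div_of_nonneg_right (by linarith) hℒ₀.le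
    exact huniq q χ hχ β β' hβ hβ' (by linarith) (by linarith)
  · -- (A)
    intro q _ χ hχ hnone s hs
    obtain ⟨σ, hσdef⟩ : ∃ σ : ℝ, s.re = σ := ⟨_, rfl⟩
    obtain ⟨t, htdef⟩ : ∃ t : ℝ, s.im = t := ⟨_, rfl⟩
    have hseq : s = σ + t * I := by
      rw [← hσdef, ← htdef]; exact (Complex.re_add_im s).symm.trans (by simp [mul_comm])
    rw [htdef]
    rw [hσdef, htdef] at hs
    set ℒ : ℝ := Real.log q + Real.log (|t| + 4) with hℒ
    set ℒ₀ : ℝ := Real.log q + Real.log 4 with hℒ₀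
    have hℒ1 : 1 ≤ ℒ := one_le_ell q t
    have hℒ0 : 0 < ℒ := by linarith
    have hℒ₀1 : 1 ≤ ℒ₀ := PagePNT.one_le_ell0 q
    have hℒ₀0 : 0 < ℒ₀ := by linarith
    have hℒ₀ℒ : ℒ₀ ≤ ℒ := by
      rw [hℒ₀, hℒ]
      have : Real.log 4 ≤ Real.log (|t| + 4) :=
        Real.log_le_log (by norm_num) (by linarith [abs_nonneg t])
      linarith
    -- the log-derivative bound `‖L'/L(u + it)‖ ≤ K ℒ` for `u ≥ σ`
    have hld : ∀ u : ℝ, σ ≤ u → χ.LFunction (u + t * I) ≠ 0 ∧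
        ‖deriv χ.LFunction (u + t * I)‖ ≤ K * ℒ * ‖χ.LFunction (u + t * I)‖ := by
      intro u hu
      have hure : ((u : ℂ) + t * I).re = u := by simp
      have huim : ((u : ℂ) + t * I).im = t := by simp
      have hureg : 1 - c / (Real.log q + Real.log (|((u : ℂ) + t * I).im| + 4)) ≤
          ((u : ℂ) + t * I).re := by
        rw [hure, huim]
        have : c / 2 / ℒ ≤ c / ℒ := div_le_div_of_nonneg_right (by linarith) hℒ0.le
        linarith
      -- either no zero right of `1 − 2c/ℒ₀`, or one zero `β₂ ∈ (1 − 2c/ℒ₀, 1 − c/ℒ₀]`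
      have hbound : χ.LFunction (u + t * I) ≠ 0 ∧
          ‖deriv χ.LFunction (u + t * I) / χ.LFunction (u + t * I)‖ ≤ K * ℒ := by
        by_cases hex : ∃ β₂ : ℝ, χ.LFunction β₂ = 0 ∧ 1 - 2 * c / ℒ₀ < β₂
        · obtain ⟨β₂, hβ₂, hβ₂c⟩ := hex
          have hβ₂le : β₂ ≤ 1 - 2 * (c / 2) / ℒ₀ := hnone β₂ hβ₂
          have hgap : c / (2 * ℒ₀) ≤ u - β₂ := by
            have h1 : c / 2 / ℒ ≤ c / 2 / ℒ₀ := div_le_div_of_nonneg_left (by linarith) hℒ₀0 hℒ₀ℒ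
            have h2 : 2 * (c / 2) / ℒ₀ = c / 2 / ℒ₀ + c / (2 * ℒ₀) := by field_simp; ring
            linarith
          have hgap0 : 0 < c / (2 * ℒ₀) := by positivity
          have hne : (u : ℂ) + t * I ≠ (β₂ : ℂ) := by
            intro h
            have := congrArg Complex.re h
            simp at this
            linarith
          obtain ⟨hL0, hb⟩ := hB q χ hχ β₂ hβ₂ hβ₂c _ hureg hne
          rw [huim] at hb
          refine ⟨hL0, ?_⟩
          have hpol : ‖1 / ((u : ℂ) + t * I - β₂)‖ ≤ 2 / c * ℒ := by
            have hre : u - β₂ ≤ ‖(u : ℂ) + t * I - β₂‖ := by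
              have := Complex.re_le_norm ((u : ℂ) + t * I - β₂)
              simpa using this
            rw [norm_div, norm_one]
            calc 1 / ‖(u : ℂ) + t * I - β₂‖ ≤ 1 / (c / (2 * ℒ₀)) :=
                  one_div_le_one_div_of_le hgap0 (hgap.trans hre)
              _ = 2 / c * ℒ₀ := by field_simp
              _ ≤ 2 / c * ℒ := mul_le_mul_of_nonneg_left hℒ₀ℒ (by positivity)
          calc ‖deriv χ.LFunction (u + t * I) / χ.LFunction (u + t * I)‖
              = ‖(deriv χ.LFunction (u + t * I) / χ.LFunction (u + t * I) -
                  1 / ((u : ℂ) + t * I - β₂)) + 1 / ((u : ℂ) + t * I - β₂)‖ := by ring_nf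
            _ ≤ ‖deriv χ.LFunction (u + t * I) / χ.LFunction (u + t * I) -
                  1 / ((u : ℂ) + t * I - β₂)‖ + ‖1 / ((u : ℂ) + t * I - β₂)‖ := norm_add_le _ _
            _ ≤ C * ℒ + 2 / c * ℒ := add_le_add hb hpol
            _ = K * ℒ := by rw [hKdef]; ring
        · push Not at hex
          have hnone' : ∀ β : ℝ, χ.LFunction β = 0 → β ≤ 1 - 2 * c / ℒ₀ :=
            fun β hβ ↦ hex β hβ
          obtain ⟨hL0, hb⟩ := hA q χ hχ hnone' _ hureg
          rw [huim] at hb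
          refine ⟨hL0, hb.trans ?_⟩
          have : 0 ≤ 2 / c * ℒ := by positivity
          rw [hKdef]; nlinarith
      obtain ⟨hL0, hb⟩ := hbound
      refine ⟨hL0, ?_⟩
      calc ‖deriv χ.LFunction (u + t * I)‖
          = ‖deriv χ.LFunction (u + t * I) / χ.LFunction (u + t * I)‖ *
              ‖χ.LFunction (u + t * I)‖ := by rw [← norm_mul, div_mul_cancel₀ _ hL0]
        _ ≤ K * ℒ * ‖χ.LFunction (u + t * I)‖ := mul_le_mul_of_nonneg_right hb (norm_nonneg _)
    have hLs : χ.LFunction s ≠ 0 := by rw [hseq]; exact (hld σ le_rfl).1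
    refine ⟨hLs, ?_⟩
    -- the two cases `σ ≥ σ₁` and `σ < σ₁`
    set σ₁ : ℝ := 1 + 1 / (8 * ℒ) with hσ₁
    rcases le_or_gt σ₁ σ with hbig | hsmall
    · have := (norm_inv_LFunction_le_right χ (s := s) hℒ1 (by rw [hσdef]; exact hbig)).2
      exact this.trans (by nlinarith)
    · have hG := norm_le_norm_mul_exp_of_deriv_le (DirichletCharacter.differentiable_LFunction hχ)
        (t := t) (K := K * ℒ) hsmall.le (fun u hu ↦ (hld u hu.1).2)
      -- the exponent
      have hexp : Real.exp (K * ℒ * (σ₁ - σ)) ≤ Real.exp κ₀ := by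
        refine Real.exp_le_exp.2 ?_
        have h1 : σ₁ - σ ≤ (1 / 8 + c) / ℒ := by
          rw [hσ₁]
          have : (1 / 8 + c) / ℒ = 1 / (8 * ℒ) + c / ℒ := by field_simp
          have h2 : c / 2 / ℒ ≤ c / ℒ := div_le_div_of_nonneg_right (by linarith) hℒ0.le
          linarith
        calc K * ℒ * (σ₁ - σ) ≤ K * ℒ * ((1 / 8 + c) / ℒ) :=
              mul_le_mul_of_nonneg_left h1 (by positivity)
          _ = κ₀ := by rw [hκ₀]; field_simp
      -- the lower bound at `σ₁`
      obtain ⟨-, hright⟩ := norm_inv_LFunction_le_right χ (s := (σ₁ : ℂ) + t * I) hℒ1 (by simp [hσ₁])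
      have hL₁0 : χ.LFunction ((σ₁ : ℂ) + t * I) ≠ 0 :=
        DirichletCharacter.LFunction_ne_zero_of_one_le_re χ (Or.inl hχ) (by simp [hσ₁]; positivity)
      have hL₁pos : 0 < ‖χ.LFunction ((σ₁ : ℂ) + t * I)‖ := norm_pos_iff.2 hL₁0
      have hLspos : 0 < ‖χ.LFunction ((σ : ℂ) + t * I)‖ := by
        rw [← hseq]; exact norm_pos_iff.2 hLs
      rw [norm_inv] at hright ⊢
      rw [hseq]
      -- `1/‖L(s)‖ ≤ exp κ₀ / ‖L(s₁)‖ ≤ 9 exp κ₀ ℒ`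
      have h1 : ‖χ.LFunction ((σ₁ : ℂ) + t * I)‖ ≤ ‖χ.LFunction ((σ : ℂ) + t * I)‖ * Real.exp κ₀ :=
        hG.trans (mul_le_mul_of_nonneg_left hexp hLspos.le)
      have h2 : ‖χ.LFunction ((σ : ℂ) + t * I)‖⁻¹ ≤
          Real.exp κ₀ * ‖χ.LFunction ((σ₁ : ℂ) + t * I)‖⁻¹ := by
        rw [inv_le_iff_one_le_mul₀ hLspos]
        calc (1 : ℝ) = ‖χ.LFunction ((σ₁ : ℂ) + t * I)‖ * ‖χ.LFunction ((σ₁ : ℂ) + t * I)‖⁻¹ :=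
              (mul_inv_cancel₀ hL₁pos.ne').symm
          _ ≤ (‖χ.LFunction ((σ : ℂ) + t * I)‖ * Real.exp κ₀) * ‖χ.LFunction ((σ₁ : ℂ) + t * I)‖⁻¹ :=
              mul_le_mul_of_nonneg_right h1 (inv_nonneg.2 (norm_nonneg _))
          _ = Real.exp κ₀ * ‖χ.LFunction ((σ₁ : ℂ) + t * I)‖⁻¹ * ‖χ.LFunction ((σ : ℂ) + t * I)‖ := by
              ring
      calc ‖χ.LFunction ((σ : ℂ) + t * I)‖⁻¹ ≤ Real.exp κ₀ * ‖χ.LFunction ((σ₁ : ℂ) + t * I)‖⁻¹ := h2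
        _ ≤ Real.exp κ₀ * (9 * ℒ) := mul_le_mul_of_nonneg_left hright (Real.exp_pos _).le
        _ = C' * ℒ := by rw [hC'def]; ring
  · -- (B)
    intro q _ χ hχ β hβ hβc'
    have hℒ₀1 : 1 ≤ Real.log q + Real.log 4 := PagePNT.one_le_ell0 q
    set ℒ₀ : ℝ := Real.log q + Real.log 4 with hℒ₀
    have hℒ₀0 : 0 < ℒ₀ := by linarith
    have hβc : 1 - 2 * c / ℒ₀ < β := by
      have : 2 * (c / 2) / ℒ₀ ≤ 2 * c / ℒ₀ := div_le_div_of_nonneg_right (by linarith) hℒ₀0.le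
      linarith
    have hβc1 : 1 - c / ℒ₀ < β := by
      have : 2 * (c / 2) / ℒ₀ = c / ℒ₀ := by ring
      linarith
    have hderiv := hsimple q χ hχ β hβ hβc
    have hβ1 : β < 1 := by
      by_contra hcon
      exact DirichletCharacter.LFunction_ne_zero_of_one_le_re χ (Or.inl hχ)
        (s := β) (by simpa using not_lt.1 hcon) hβ
    -- the quotient `g = dslope L β`
    set g : ℂ → ℂ := dslope χ.LFunction (β : ℂ) with hgdef
    have hgd : Differentiable ℂ g := PagePNT.differentiable_dslope_LFunction χ hχ _
    have hgβ : g β = deriv χ.LFunction β := by rw [hgdef, dslope_same]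
    -- `‖g'(w)‖ ≤ C ℒ_w ‖g(w)‖` at points of the region `≠ β`
    have hgld : ∀ w : ℂ, 1 - c / (Real.log q + Real.log (|w.im| + 4)) ≤ w.re → w ≠ β →
        χ.LFunction w ≠ 0 ∧
        ‖deriv g w‖ ≤ C * (Real.log q + Real.log (|w.im| + 4)) * ‖g w‖ := by
      intro w hw hwβ
      obtain ⟨hL0, hb⟩ := hB q χ hχ β hβ hβc w hw hwβ
      refine ⟨hL0, ?_⟩
      have hg0 : g w ≠ 0 := PagePNT.dslope_ne_zero_of_ne χ hβ hL0
      have heq := PagePNT.logDeriv_LFunction_eq_add χ hχ hβ hL0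
      have hquot : deriv g w / g w = deriv χ.LFunction w / χ.LFunction w - 1 / (w - β) := by
        rw [heq, hgdef]; ring
      calc ‖deriv g w‖ = ‖deriv g w / g w‖ * ‖g w‖ := by rw [← norm_mul, div_mul_cancel₀ _ hg0]
        _ ≤ C * (Real.log q + Real.log (|w.im| + 4)) * ‖g w‖ := by
            rw [hquot]; exact mul_le_mul_of_nonneg_right hb (norm_nonneg _)
    -- the segment bound at height `t`, including the point `β` itself
    have hseg : ∀ (t σ₀ σ₁ : ℝ), 1 - c / (Real.log q + Real.log (|t| + 4)) ≤ σ₀ →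
        ((σ₀ : ℂ) + t * I ≠ β ∨ (t = 0 ∧ σ₀ = β)) → σ₀ < σ₁ →
        ∀ u ∈ Set.Ico σ₀ σ₁, ‖deriv g (u + t * I)‖ ≤
          C * (Real.log q + Real.log (|t| + 4)) * ‖g (u + t * I)‖ := by
      intro t σ₀ σ₁ hσ₀ hstart hσ₀₁ u hu
      have hgen : ∀ v : ℝ, σ₀ ≤ v → (v : ℂ) + t * I ≠ β →
          ‖deriv g (v + t * I)‖ ≤ C * (Real.log q + Real.log (|t| + 4)) * ‖g (v + t * I)‖ := by
        intro v hv hvβ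
        have h := (hgld ((v : ℂ) + t * I) (by simpa using hσ₀.trans hv) hvβ).2
        simpa using h
      by_cases huβ : (u : ℂ) + t * I = β
      · -- then `t = 0`, `u = β`: pass to the limit from the right
        have ht : t = 0 := by
          have := congrArg Complex.im huβ; simpa using this
        have huβ' : u = β := by
          have := congrArg Complex.re huβ; simpa using this
        subst huβ'
        refine deriv_le_at_left_of_Ioo hgd (σ₁ := σ₁) hu.2 fun v hv ↦ hgen v (hu.1.trans hv.1.le) ?_
        intro h
        have := congrArg Complex.re h
        simp at this
        linarith [hv.1]
      · exact hgen u hu.1 huβ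
    refine ⟨hderiv, ?_, ?_⟩
    · -- `‖1/L'(β)‖ ≤ C' ℒ₀`: Grönwall on `[β, 1 + 1/(8ℒ₀)]` at height `0`
      set σ₁ : ℝ := 1 + 1 / (8 * ℒ₀) with hσ₁
      have hκ : 0 < 1 / (8 * ℒ₀) := by positivity
      have hκ1 : 1 / (8 * ℒ₀) ≤ 1 / 8 := by
        rw [div_le_div_iff₀ (by positivity) (by norm_num)]; linarith
      have hβσ₁ : β < σ₁ := by linarith
      have hℒ₀t : Real.log q + Real.log (|(0 : ℝ)| + 4) = ℒ₀ := by rw [abs_zero, zero_add]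
      have hG := norm_le_norm_mul_exp_of_deriv_le hgd (t := 0) (K := C * ℒ₀) hβσ₁.le
        (fun u hu ↦ by
          have h := hseg 0 β σ₁ (by rw [hℒ₀t]; have : c / 2 / ℒ₀ ≤ c / ℒ₀ :=
              div_le_div_of_nonneg_right (by linarith) hℒ₀0.le; linarith)
            (Or.inr ⟨rfl, rfl⟩) hβσ₁ u hu
          rwa [hℒ₀t] at h)
      simp only [Complex.ofReal_zero, zero_mul, add_zero] at hG
      have hexp : Real.exp (C * ℒ₀ * (σ₁ - β)) ≤ Real.exp κ₀ := by
        refine Real.exp_le_exp.2 ?_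
        have h1 : σ₁ - β ≤ (1 / 8 + c) / ℒ₀ := by
          have : (1 / 8 + c) / ℒ₀ = 1 / (8 * ℒ₀) + c / ℒ₀ := by field_simp
          rw [this, hσ₁]; linarith
        calc C * ℒ₀ * (σ₁ - β) ≤ C * ℒ₀ * ((1 / 8 + c) / ℒ₀) :=
              mul_le_mul_of_nonneg_left h1 (by positivity)
          _ = C * (1 / 8 + c) := by field_simp
          _ ≤ κ₀ := by
              rw [hκ₀, hKdef]
              have : 0 ≤ 2 / c * (1 / 8 + c) := by positivity
              nlinarith
      -- `g(σ₁) = L(σ₁)/(σ₁ − β)` and `‖L(σ₁)‖ ≥ 1/(9ℒ₀)`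
      obtain ⟨hL₁0, hright⟩ := norm_inv_LFunction_le_right χ (s := (σ₁ : ℂ)) hℒ₀1 (by simp [hσ₁])
      have hgσ₁ : g σ₁ = χ.LFunction σ₁ / ((σ₁ : ℂ) - β) := by
        have h := PagePNT.LFunction_eq_mul_dslope χ hβ (σ₁ : ℂ)
        have hne : (σ₁ : ℂ) - β ≠ 0 := by
          rw [← Complex.ofReal_sub]; exact_mod_cast (by linarith : σ₁ - β ≠ 0)
        rw [hgdef, h]; field_simp
      have hnormσβ : ‖(σ₁ : ℂ) - β‖ = σ₁ - β := by
        rw [← Complex.ofReal_sub, Complex.norm_real, Real.norm_of_nonneg (by linarith)]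
      have hL₁pos : 0 < ‖χ.LFunction (σ₁ : ℂ)‖ := norm_pos_iff.2 hL₁0
      have hgσ₁pos : 0 < ‖g σ₁‖ := by
        rw [hgσ₁, norm_div, hnormσβ]; exact div_pos hL₁pos (by linarith)
      have hgβpos : 0 < ‖g β‖ := by rw [hgβ]; exact norm_pos_iff.2 hderiv
      rw [← hgβ, norm_inv, inv_le_iff_one_le_mul₀ hgβpos]
      rw [norm_inv] at hright
      -- `1 ≤ 9ℒ₀ ‖L(σ₁)‖`, `‖L(σ₁)‖ = (σ₁ − β)‖g(σ₁)‖ ≤ ‖g σ₁‖ ≤ ‖g β‖ exp κ₀`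
      have h1 : 1 ≤ 9 * ℒ₀ * ‖χ.LFunction (σ₁ : ℂ)‖ := by
        have := (inv_le_iff_one_le_mul₀ hL₁pos).1 hright
        linarith
      have h2 : ‖χ.LFunction (σ₁ : ℂ)‖ ≤ ‖g σ₁‖ := by
        rw [hgσ₁, norm_div, hnormσβ, le_div_iff₀ (by linarith)]
        have hcℒ₀ : c / ℒ₀ ≤ c := div_le_self hcpos.le hℒ₀1
        have hsb1 : σ₁ - β ≤ 1 := by rw [hσ₁]; linarith
        nlinarith
      have h3 : ‖g σ₁‖ ≤ ‖g β‖ * Real.exp κ₀ :=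
        hG.trans (mul_le_mul_of_nonneg_left hexp hgβpos.le)
      calc (1 : ℝ) ≤ 9 * ℒ₀ * ‖χ.LFunction (σ₁ : ℂ)‖ := h1
        _ ≤ 9 * ℒ₀ * (‖g β‖ * Real.exp κ₀) := by
            refine mul_le_mul_of_nonneg_left (h2.trans h3) (by positivity)
        _ = C' * ℒ₀ * ‖g β‖ := by rw [hC'def]; ring
        _ = C' * (Real.log q + Real.log 4) * ‖g ↑β‖ := by rw [hℒ₀]
    · -- the bound for `1/L(s)`, `s ≠ β`
      intro s hs hsβ
      obtain ⟨σ, hσdef⟩ : ∃ σ : ℝ, s.re = σ := ⟨_, rfl⟩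
      obtain ⟨t, htdef⟩ : ∃ t : ℝ, s.im = t := ⟨_, rfl⟩
      have hseq : s = σ + t * I := by
        rw [← hσdef, ← htdef]; exact (Complex.re_add_im s).symm.trans (by simp [mul_comm])
      rw [htdef]
      rw [hσdef, htdef] at hs
      set ℒ : ℝ := Real.log q + Real.log (|t| + 4) with hℒ
      have hℒ1 : 1 ≤ ℒ := one_le_ell q t
      have hℒ0 : 0 < ℒ := by linarith
      have hsreg : 1 - c / ℒ ≤ σ := by
        have : c / 2 / ℒ ≤ c / ℒ := div_le_div_of_nonneg_right (by linarith) hℒ0.le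
        linarith
      have hLs : χ.LFunction s ≠ 0 :=
        (hgld s (by rw [hσdef, htdef]; exact hsreg) hsβ).1
      refine ⟨hLs, ?_⟩
      have hsβpos : 0 < ‖s - β‖ := norm_pos_iff.2 (sub_ne_zero.2 hsβ)
      have hfac1 : 1 ≤ 1 + ‖s - (β : ℂ)‖⁻¹ := by
        have := inv_nonneg.2 hsβpos.le; linarith
      set σ₁ : ℝ := 1 + 1 / (8 * ℒ) with hσ₁
      have hκ : 0 < 1 / (8 * ℒ) := by positivity
      have hκ1 : 1 / (8 * ℒ) ≤ 1 / 8 := by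
        rw [div_le_div_iff₀ (by positivity) (by norm_num)]; linarith
      rcases le_or_gt σ₁ σ with hbig | hsmall
      · have := (norm_inv_LFunction_le_right χ (s := s) hℒ1 (by rw [hσdef]; exact hbig)).2
        calc ‖(χ.LFunction s)⁻¹‖ ≤ 9 * ℒ := this
          _ ≤ C' * ℒ * 1 := by nlinarith
          _ ≤ C' * ℒ * (1 + ‖s - (β : ℂ)‖⁻¹) :=
              mul_le_mul_of_nonneg_left hfac1 (by positivity)
      · -- Grönwall for `g` on `[σ, σ₁] + it`
        have hstart : ((σ : ℂ) + t * I ≠ β ∨ (t = 0 ∧ σ = β)) := Or.inl (by rw [← hseq]; exact hsβ)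
        have hG := norm_le_norm_mul_exp_of_deriv_le hgd (t := t) (K := C * ℒ) hsmall.le
          (hseg t σ σ₁ hsreg hstart hsmall)
        have hexp : Real.exp (C * ℒ * (σ₁ - σ)) ≤ Real.exp κ₀ := by
          refine Real.exp_le_exp.2 ?_
          have h1 : σ₁ - σ ≤ (1 / 8 + c) / ℒ := by
            have : (1 / 8 + c) / ℒ = 1 / (8 * ℒ) + c / ℒ := by field_simp
            rw [this, hσ₁]; linarith
          calc C * ℒ * (σ₁ - σ) ≤ C * ℒ * ((1 / 8 + c) / ℒ) :=
                mul_le_mul_of_nonneg_left h1 (by positivity)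
            _ = C * (1 / 8 + c) := by field_simp
            _ ≤ κ₀ := by
                rw [hκ₀, hKdef]
                have : 0 ≤ 2 / c * (1 / 8 + c) := by positivity
                nlinarith
        set s₁ : ℂ := (σ₁ : ℂ) + t * I with hs₁
        obtain ⟨hL₁0, hright⟩ := norm_inv_LFunction_le_right χ (s := s₁) hℒ1 (by simp [hs₁, hσ₁])
        have hs₁β : s₁ - β ≠ 0 := by
          intro h
          have := congrArg Complex.re h
          simp [hs₁] at this
          linarith
        have hgs₁ : g s₁ = χ.LFunction s₁ / (s₁ - β) := by
          have h := PagePNT.LFunction_eq_mul_dslope χ hβ s₁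
          rw [hgdef, h]; field_simp
        have hgs : χ.LFunction s = (s - β) * g s := by
          rw [hgdef]; exact PagePNT.LFunction_eq_mul_dslope χ hβ s
        have hL₁pos : 0 < ‖χ.LFunction s₁‖ := norm_pos_iff.2 hL₁0
        have hs₁βpos : 0 < ‖s₁ - β‖ := norm_pos_iff.2 hs₁β
        have hgs₁pos : 0 < ‖g s₁‖ := by rw [hgs₁, norm_div]; exact div_pos hL₁pos hs₁βpos
        have hgspos : 0 < ‖g s‖ := by
          have := norm_pos_iff.2 hLs
          rw [hgs, norm_mul] at this
          exact pos_of_mul_pos_right this (norm_nonneg _)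
        rw [← hseq] at hG
        -- `‖s₁ − β‖ ≤ ‖s₁ − s‖ + ‖s − β‖ ≤ 1 + ‖s − β‖`
        have hs₁s : ‖s₁ - s‖ ≤ 1 := by
          have : s₁ - s = ((σ₁ - σ : ℝ) : ℂ) := by rw [hs₁, hseq]; push_cast; ring
          rw [this, Complex.norm_real, Real.norm_of_nonneg (by linarith)]
          rw [hσ₁]; linarith [hsreg.trans' (show 1 - c / ℒ ≥ 1 - c from by
            have := div_le_self hcpos.le hℒ1; linarith)]
        have htri : ‖s₁ - (β : ℂ)‖ ≤ 1 + ‖s - β‖ := by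
          calc ‖s₁ - (β : ℂ)‖ = ‖(s₁ - s) + (s - β)‖ := by ring_nf
            _ ≤ ‖s₁ - s‖ + ‖s - β‖ := norm_add_le _ _
            _ ≤ 1 + ‖s - β‖ := by linarith
        -- assemble: `1/‖L s‖ = 1/(‖s-β‖ ‖g s‖) ≤ exp κ₀/(‖s-β‖ ‖g s₁‖) = exp κ₀ ‖s₁-β‖/(‖s-β‖ ‖L s₁‖)`
        rw [norm_inv] at hright ⊢
        rw [inv_le_iff_one_le_mul₀ (norm_pos_iff.2 hLs)]
        have h1 : 1 ≤ 9 * ℒ * ‖χ.LFunction s₁‖ := by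
          have := (inv_le_iff_one_le_mul₀ hL₁pos).1 hright
          linarith
        have h2 : ‖χ.LFunction s₁‖ = ‖s₁ - β‖ * ‖g s₁‖ := by
          rw [hgs₁, norm_div, mul_div_cancel₀ _ hs₁βpos.ne']
        have h3 : ‖g s₁‖ ≤ ‖g s‖ * Real.exp κ₀ :=
          hG.trans (mul_le_mul_of_nonneg_left hexp hgspos.le)
        have h4 : ‖g s‖ = ‖χ.LFunction s‖ / ‖s - β‖ := by
          rw [hgs, norm_mul, mul_div_cancel_left₀ _ hsβpos.ne']
        calc (1 : ℝ) ≤ 9 * ℒ * ‖χ.LFunction s₁‖ := h1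
          _ = 9 * ℒ * (‖s₁ - β‖ * ‖g s₁‖) := by rw [h2]
          _ ≤ 9 * ℒ * ((1 + ‖s - β‖) * (‖g s‖ * Real.exp κ₀)) := by
              refine mul_le_mul_of_nonneg_left ?_ (by positivity)
              exact mul_le_mul htri h3 hgs₁pos.le (by positivity)
          _ = C' * ℒ * ((1 + ‖s - β‖) / ‖s - β‖) * ‖χ.LFunction s‖ := by
              rw [h4, hC'def]; field_simp
          _ = C' * ℒ * (1 + ‖s - (β : ℂ)‖⁻¹) * ‖χ.LFunction s‖ := by
              congr 2
              field_simp
              ring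

end Literature.NumberTheory.LFunctions.DirichletZFR
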